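import Literature.NumberTheory.LFunctions.BurnolDilationCriterionProofs
import Literature.NumberTheory.LFunctions.BurnolPeriodizationCriterionProofs
import Literature.Analysis.FunctionSpaces.SmoothParametricIntegral
import Mathlib.MeasureTheory.Function.ContinuousMapDense
import Mathlib.MeasureTheory.Measure.Haar.NormedSpace
import Mathlib.Topology.UniformSpace.HeineCantor
import HarnessLib

/-!
# Burnol 2001, Thm 2.7 (equality clause): `cl V E(𝒮_{≤1}) = ℍ² ⟺ RH` — DISCHARGED

LABEL (line 1): RH-EQUIVALENT·PRINTED criterion proved AS AN EQUIVALENCE (neither side asserted).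
`Literature.NumberTheory.LFunctions.Burnol2001_thm_2_7_iff` (`cl(V E(𝒮_{≤1})) = ℍ² ↔ RH`; the
inclusion `cl V E(𝒮_{≤1}) ⊂ ℍ²` is the tree theorem `Burnol2001_thm_2_7_subset_holds`) is
discharged here as `Burnol2001_thm_2_7_iff_holds`: the `equality ⟹ RH` half by Burnol's printed
Mellin computation (`riemannHypothesis_of_opV_mapE_closure`), the `RH ⟹ equality` half
(`opV_mapE_closure_of_riemannHypothesis`) by an ELEMENTARY road replacing Burnol's Beurling–Lax /
outer-function argument (absent from Mathlib): the already proved Thm 2.6 + dilation invariance +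
the exact identity `V E(φ̃) = T(ψ)` (second part of this file). bears_on: LADDER-RH B-C/B-P
(COLUMN 6 DBR). WHAT THIS IS NOT: a proof or disproof of RH — an equivalence fixes WHICH closure
statement is RH, it does not move RH; nothing here bears on the truth of RH.

Source: J.-F. Burnol, J. Number Theory 87 (2001) 253–269 = arXiv:math/0001013v3 [Burnol2001], §2,
TeX l.440–499 (Thm 2.6, the functions `E(φ)`, `V E(φ)`, their Mellin transforms, Thm 2.7).

## Part 1 — `equality ⟹ RH`: the printed computation, followed here

Burnol (l.470–487): the Mellin transform `Ê(φ)(s) = ∫_0^∞ E(φ)(u)u^{s−1} du` "is absolutely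
convergent and analytic for `0 < Re(s) < 1`. It can be rewritten as
`∫_0^1 E(φ)(u)u^{s−1} du + ∫_1^∞ Σ_{n≥1} φ(nu) u^{s−1} du + (∫_0^∞ φ)/(s−1)`, which is then valid
in the half-plane `Re(s) > 0`. Then, for `Re(s) > 1`, … simply as `Σ n^{−s} ∫_0^∞ φ(u)u^{s−1} du
= ζ(s)φ̂(s)`, which remains valid for `Re(s) > 0`. … `V` … acts as `(s−1)/s` … for
`φ ∈ 𝒮_{≤1}`, `VE(φ)` has support in `(0,1]` and its Mellin transform `((s−1)/s)ζ(s)φ̂(s)` …".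

* `Burnol2001.IsTest.mellin_mapT_eq_of_one_lt_re`: `∫_0^∞ (Σ_{n≥1}φ(nu)) u^{s−1} du = ζ(s)φ̂(s)`,
  `Re s > 1` (termwise; for `φ ∈ 𝒮_{≤1}` the middle integral `∫_1^∞ Σφ(nu)…` above vanishes).
* `Burnol2001.IsTest.mellin_indicator_mapE_eq`: the split continuation —
  `(s−1)∫_0^1 E(φ)(u)u^{s−1} du + ∫_0^∞ φ = ζ₁(s)φ̂(s)` on `Re s > 0` (identity theorem, with
  Mathlib's entire `riemannZeta₁ = (s−1)ζ(s)`).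
* `Burnol2001.IsTest.hasMellin_mapE_zero` / `hasMellin_opV_mapE_zero`: at a zero `s₀` of `ζ` with
  `0 < Re s₀ < 1`, `Ê(φ)(s₀) = 0` and, by the spectral action of `V`
  (`Burnol2001.hasMellin_integral_Ioi_div`), `(VE(φ))^(s₀) = 0`.
* `riemannHypothesis_of_opV_mapE_closure`: with `g = 𝟙_{(0,1]} ∈ ℍ²`, density of `V E(𝒮_{≤1})`
  in `ℍ²` at a zero `s₀`, `½ < Re s₀ < 1`, contradicts `∫_0^1 u^{s₀−1} du = 1/s₀ ≠ 0`
  (Cauchy–Schwarz, `ε → 0`), and `quasiRiemannHypothesis_one_half_iff_holds` finishes.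

## Part 2 — `RH ⟹ equality`: Thm 2.6, dilations, and `V E(φ̃) = T(ψ)`

* `Burnol2001.IsTest0.isTest_tilde`, `Burnol2001.IsTest0.opV_mapE_tilde_eq`: for `ψ ∈ 𝒮⁰_{≤1}`
  the function `φ̃(x) = ψ̃(x) − ∫_0^1 ψ̃(xσ) dσ` (`ψ̃(x) = ψ(x) + ψ(−x)`) lies in `𝒮_{≤1}` and
  `V E(φ̃) = T(ψ)` on `(0,∞)` — `E = T − c/u`, `V(c/u) = 0` (`IsTest.opV_const_div_eq_zero`),
  and one FTC for `w ↦ w^{-1}∫_0^w ψ` whose derivative is `φ̃(w)/w`.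
* `Burnol2001.approxT_indicator` / `approxT_continuous` / `approxT_memLp`: if `1` is an
  `L²(0,1)`-limit of `T(𝒮⁰_{≤1})` (Thm 2.6 under RH), then so are the `𝟙_{(0,b]}` (dilation
  `ψ ↦ ψ(·/b)`), the `Ioc`-step functions, the continuous compactly supported functions (uniform
  continuity) and finally every `g ∈ L²(0,1)` (`MemLp.exists_hasCompactSupport_eLpNorm_sub_le`).
* `opV_mapE_closure_of_riemannHypothesis` and `Burnol2001_thm_2_7_iff_holds`.

No new definitions, no new named facts; net debt −1.

## References
* [Burnol2001] J.-F. Burnol, *An adelic causality problem related to abelian L-functions*,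
  J. Number Theory 87 (2001) 253–269 = arXiv:math/0001013v3, Thm 2.6, Thm 2.7 and l.440–499.
-/

noncomputable section

open Complex Filter MeasureTheory Set Asymptotics
open scoped Real Topology ContDiff

namespace Literature.NumberTheory.LFunctions

namespace Burnol2001

namespace IsTest

variable {φ : ℝ → ℂ}

/-! ## Bounds for `φ ∈ 𝒮_{≤1}` and its periodization -/

/-- `φ ∈ 𝒮_{≤1}` is bounded: `‖φ x‖ ≤ 2L` for a Lipschitz constant `L` on `[0, ∞)` (`φ(2) = 0`,
`φ` even). [cite: Burnol2001, §2 (before Thm 2.7)] -/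
theorem norm_le_of_lipschitz (hφ : IsTest φ) {L : ℝ} (hL0 : 0 ≤ L)
    (hL : ∀ x y : ℝ, 0 ≤ x → 0 ≤ y → ‖φ y - φ x‖ ≤ L * |y - x|) (x : ℝ) : ‖φ x‖ ≤ 2 * L := by
  wlog hx : 0 ≤ x generalizing x with H
  · have := H (-x) (by linarith)
    rwa [hφ.2.1 x] at this
  by_cases hx1 : 1 < x
  · rw [hφ.eq_zero_of_one_lt hx1, norm_zero]; positivity
  push Not at hx1
  have h2 : φ 2 = 0 := hφ.eq_zero_of_one_lt (by norm_num)
  have := hL 2 x (by norm_num) hx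
  rw [h2, sub_zero] at this
  refine this.trans ?_
  have : |x - 2| ≤ 2 := by rw [abs_le]; constructor <;> linarith
  nlinarith

/-- The Mellin transform `φ̂` of `φ ∈ 𝒮_{≤1}` converges absolutely for `0 < Re s`.
[cite: Burnol2001, §2 (before Thm 2.7)] -/
theorem mellinConvergent (hφ : IsTest φ) {s : ℂ} (hs : 0 < s.re) : MellinConvergent φ s := by
  obtain ⟨L, hL0, hL⟩ := hφ.exists_lipschitz
  refine mellinConvergent_of_isBigO_rpow (a := s.re + 1) (b := 0)
    (hφ.continuous.continuousOn.locallyIntegrableOn measurableSet_Ioi) ?_ (by linarith) ?_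
    (by simpa using hs)
  · have h0 : φ =ᶠ[atTop] 0 := by
      filter_upwards [eventually_gt_atTop 1] with t ht using hφ.eq_zero_of_one_lt ht
    exact (isBigO_zero _ _).congr' h0.symm EventuallyEq.rfl
  · refine IsBigO.of_bound (2 * L) ?_
    filter_upwards [self_mem_nhdsWithin] with t (ht : 0 < t)
    simpa [Real.rpow_zero] using hφ.norm_le_of_lipschitz hL0 hL t

/-- `φ̂` is holomorphic on `0 < Re s` for `φ ∈ 𝒮_{≤1}`. [cite: Burnol2001, §2 (before Thm 2.7)] -/
theorem differentiableAt_mellin (hφ : IsTest φ) {s : ℂ} (hs : 0 < s.re) :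
    DifferentiableAt ℂ (mellin φ) s := by
  obtain ⟨L, hL0, hL⟩ := hφ.exists_lipschitz
  refine mellin_differentiableAt_of_isBigO_rpow (a := s.re + 1) (b := 0)
    (hφ.continuous.continuousOn.locallyIntegrableOn measurableSet_Ioi) ?_ (by linarith) ?_
    (by simpa using hs)
  · have h0 : φ =ᶠ[atTop] 0 := by
      filter_upwards [eventually_gt_atTop 1] with t ht using hφ.eq_zero_of_one_lt ht
    exact (isBigO_zero _ _).congr' h0.symm EventuallyEq.rfl
  · refine IsBigO.of_bound (2 * L) ?_
    filter_upwards [self_mem_nhdsWithin] with t (ht : 0 < t)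
    simpa [Real.rpow_zero] using hφ.norm_le_of_lipschitz hL0 hL t

/-- For `u > 1`, `T(φ)(u) = Σ_{n≥1} φ(nu) = 0`. [cite: Burnol2001, §2 (before Thm 2.7)] -/
theorem mapT_eq_zero_of_one_lt (hφ : IsTest φ) {u : ℝ} (hu : 1 < u) : mapT φ u = 0 :=
  hφ.tsum_eq_zero_of_one_lt hu

/-- `T(φ)` is continuous on `(0,∞)` (locally a finite sum). [cite: Burnol2001, §2 (before Thm 2.7)] -/
theorem continuousOn_mapT (hφ : IsTest φ) : ContinuousOn (mapT φ) (Ioi 0) := by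
  intro u₀ hu₀
  have hu₀' : (0 : ℝ) < u₀ := hu₀
  set M : ℕ := ⌈1 / (u₀ / 2)⌉₊ with hM
  have hloc : ∀ u ∈ Ioi (u₀ / 2), mapT φ u = ∑ n ∈ Finset.range M, φ ((n + 1 : ℕ) * u) := by
    intro u hu
    have hu' : (0 : ℝ) < u := lt_trans (half_pos hu₀') hu
    have hMu : 1 / u ≤ M := by
      refine le_trans ?_ (Nat.le_ceil _)
      exact one_div_le_one_div_of_le (half_pos hu₀') (le_of_lt hu)
    rw [mapT, hφ.tsum_eq_sum_range hu' hMu]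
  have hcont : ContinuousOn (fun u : ℝ ↦ ∑ n ∈ Finset.range M, φ ((n + 1 : ℕ) * u))
      (Ioi (u₀ / 2)) :=
    (continuous_finsetSum _ fun n _ ↦
      hφ.continuous.comp (continuous_const.mul continuous_id)).continuousOn
  have hmem : Ioi (u₀ / 2) ∈ 𝓝 u₀ := Ioi_mem_nhds (by linarith)
  have key : ContinuousAt (mapT φ) u₀ := by
    have h1 : ContinuousAt (fun u : ℝ ↦ ∑ n ∈ Finset.range M, φ ((n + 1 : ℕ) * u)) u₀ :=
      hcont.continuousAt hmem
    refine h1.congr ?_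
    filter_upwards [hmem] with u hu using (hloc u hu).symm
  exact key.continuousWithinAt

/-- On `(0,1]`: `‖T(φ)(u)‖ ≤ (2L + ‖∫φ‖)·u^{−1}` (from `|uT(φ)(u) − ∫φ| ≤ 2Lu`).
[cite: Burnol2001, §2 (before Thm 2.7)] -/
theorem norm_mapT_le (hφ : IsTest φ) {L : ℝ} (hL0 : 0 ≤ L)
    (hL : ∀ x y : ℝ, 0 ≤ x → 0 ≤ y → ‖φ y - φ x‖ ≤ L * |y - x|) {u : ℝ} (hu : 0 < u)
    (hu1 : u ≤ 1) : ‖mapT φ u‖ ≤ (2 * L + ‖∫ x in Ioi (0 : ℝ), φ x‖) * u⁻¹ := by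
  have h := hφ.norm_mul_tsum_sub_integral_le hL0 hL hu hu1
  have hu' : (u : ℂ) ≠ 0 := by exact_mod_cast hu.ne'
  have e : mapT φ u = ((u : ℂ) * ∑' n : ℕ, φ ((n + 1 : ℕ) * u)) / u := by
    rw [mapT, mul_div_cancel_left₀ _ hu']
  rw [e, norm_div, Complex.norm_real, Real.norm_eq_abs, abs_of_pos hu, div_eq_mul_inv]
  refine mul_le_mul_of_nonneg_right ?_ (inv_nonneg.2 hu.le)
  calc ‖(u : ℂ) * ∑' n : ℕ, φ ((n + 1 : ℕ) * u)‖
      = ‖((u : ℂ) * ∑' n : ℕ, φ ((n + 1 : ℕ) * u) - ∫ x in Ioi (0 : ℝ), φ x) +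
          ∫ x in Ioi (0 : ℝ), φ x‖ := by rw [sub_add_cancel]
    _ ≤ 2 * L * u + ‖∫ x in Ioi (0 : ℝ), φ x‖ := (norm_add_le _ _).trans (by linarith)
    _ ≤ 2 * L + ‖∫ x in Ioi (0 : ℝ), φ x‖ := by nlinarith

/-- The Mellin transform of `T(φ)` converges absolutely for `Re s > 1` (`T(φ) = O(1/u)` at `0`,
`= 0` on `(1,∞)`). [cite: Burnol2001, §2 (before Thm 2.7)] -/
theorem mellinConvergent_mapT (hφ : IsTest φ) {s : ℂ} (hs : 1 < s.re) :
    MellinConvergent (mapT φ) s := by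
  obtain ⟨L, hL0, hL⟩ := hφ.exists_lipschitz
  refine mellinConvergent_of_isBigO_rpow (a := s.re + 1) (b := 1)
    (hφ.continuousOn_mapT.locallyIntegrableOn measurableSet_Ioi) ?_ (by linarith) ?_ hs
  · have h0 : mapT φ =ᶠ[atTop] 0 := by
      filter_upwards [eventually_gt_atTop 1] with t ht using hφ.mapT_eq_zero_of_one_lt ht
    exact (isBigO_zero _ _).congr' h0.symm EventuallyEq.rfl
  · refine IsBigO.of_bound (2 * L + ‖∫ x in Ioi (0 : ℝ), φ x‖) ?_
    have hmem : Ioo (0 : ℝ) 1 ∈ 𝓝[>] (0 : ℝ) := Ioo_mem_nhdsGT zero_lt_one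
    filter_upwards [hmem] with t ht
    rw [Real.norm_eq_abs, abs_of_pos (Real.rpow_pos_of_pos ht.1 _), Real.rpow_neg_one]
    exact hφ.norm_mapT_le hL0 hL ht.1 ht.2.le

/-- **`T̂(φ)(s) = ζ(s)φ̂(s)` for `Re s > 1`** ("for `Re(s) > 1` … simply as
`Σ n^{−s} ∫_0^∞ φ(u)u^{s−1} du = ζ(s)φ̂(s)`"). [cite: Burnol2001, §2 (before Thm 2.7), TeX l.476–480] -/
theorem mellin_mapT_eq_of_one_lt_re (hφ : IsTest φ) {s : ℂ} (hs : 1 < s.re) :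
    mellin (mapT φ) s = riemannZeta s * mellin φ s := by
  have hs0 : 0 < s.re := by linarith
  set F : ℕ → ℝ → ℂ := fun n t ↦ (t : ℂ) ^ (s - 1) • φ ((n + 1 : ℕ) * t) with hF
  have hconv : MellinConvergent φ s := hφ.mellinConvergent hs0
  have hFint : ∀ n, Integrable (F n) (volume.restrict (Ioi 0)) := by
    intro n
    have := (MellinConvergent.comp_mul_left (f := φ) (s := s) (a := ((n + 1 : ℕ) : ℝ))
      (by positivity)).2 hconv
    exact this
  set g : ℝ → ℝ := fun x ↦ x ^ (s.re - 1) * ‖φ x‖ with hg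
  have hFnorm : ∀ n : ℕ, ∫ t in Ioi (0 : ℝ), ‖F n t‖ =
      ((n + 1 : ℕ) : ℝ) ^ (-s.re) * ∫ x in Ioi (0 : ℝ), g x := by
    intro n
    have hn : (0 : ℝ) < (n + 1 : ℕ) := by positivity
    have h1 : ∀ t ∈ Ioi (0 : ℝ), ‖F n t‖ =
        ((n + 1 : ℕ) : ℝ) ^ (1 - s.re) * g ((n + 1 : ℕ) * t) := by
      intro t ht
      have ht' : (0 : ℝ) < t := ht
      simp only [hF, hg, norm_smul, norm_cpow_eq_rpow_re_of_pos ht', sub_re, one_re]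
      rw [Real.mul_rpow hn.le ht'.le, ← mul_assoc, ← mul_assoc, ← Real.rpow_add hn]
      norm_num
    rw [setIntegral_congr_fun measurableSet_Ioi h1, integral_const_mul,
      integral_comp_mul_left_Ioi g 0 hn, mul_zero, smul_eq_mul, ← mul_assoc]
    congr 1
    rw [Real.rpow_sub hn, Real.rpow_one, Real.rpow_neg hn.le]
    field_simp
  have hsum : Summable fun n ↦ ∫ t in Ioi (0 : ℝ), ‖F n t‖ := by
    simp_rw [hFnorm]
    refine Summable.mul_right _ ?_
    have h := (summable_nat_add_iff 1).2 (Real.summable_nat_rpow.2 (by linarith : -s.re < -1))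
    exact_mod_cast h
  have hswap : ∫ t in Ioi (0 : ℝ), ∑' n, F n t = ∑' n, ∫ t in Ioi (0 : ℝ), F n t :=
    (integral_tsum_of_summable_integral_norm hFint hsum).symm
  have hterm : ∀ n : ℕ, ∫ t in Ioi (0 : ℝ), F n t = (1 / ((n : ℂ) + 1) ^ s) * mellin φ s := by
    intro n
    have hn : (0 : ℝ) < (n + 1 : ℕ) := by positivity
    have := mellin_comp_mul_left φ s hn
    rw [mellin] at this
    simp only [hF]
    rw [this, smul_eq_mul]
    congr 1
    rw [cpow_neg, one_div]
    push_cast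
    ring
  calc mellin (mapT φ) s = ∫ t in Ioi (0 : ℝ), ∑' n, F n t := by
        rw [mellin]
        refine setIntegral_congr_fun measurableSet_Ioi fun t _ ↦ ?_
        simp only [hF, mapT, smul_eq_mul]
        rw [tsum_mul_left]
    _ = ∑' n, ∫ t in Ioi (0 : ℝ), F n t := hswap
    _ = ∑' n : ℕ, (1 / ((n : ℂ) + 1) ^ s) * mellin φ s := tsum_congr hterm
    _ = riemannZeta s * mellin φ s := by
        rw [tsum_mul_right, zeta_eq_tsum_one_div_nat_add_one_cpow hs]

/-! ## `E(φ)` cut at `1`: analyticity on `Re s > 0` and the split continuation -/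

/-- `E(φ)` is a.e.-strongly measurable on `(0,∞)`. [cite: Burnol2001, §2 (before Thm 2.7)] -/
theorem aestronglyMeasurable_mapE (hφ : IsTest φ) :
    AEStronglyMeasurable (mapE φ) (volume.restrict (Ioi (0 : ℝ))) :=
  hφ.continuousOn_mapE.aestronglyMeasurable measurableSet_Ioi

/-- The Mellin transform of `𝟙_{(0,1]}·E(φ)` converges absolutely and is holomorphic on
`0 < Re s` (`E(φ)` is bounded on `(0,1]`, `‖E(φ)(u)‖ ≤ 2L`). [cite: Burnol2001, §2 (before
Thm 2.7), TeX l.470–474] -/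
theorem hasMellin_indicator_mapE_aux (hφ : IsTest φ) {s : ℂ} (hs : 0 < s.re) :
    MellinConvergent ((Ioc (0 : ℝ) 1).indicator (mapE φ)) s ∧
      DifferentiableAt ℂ (mellin ((Ioc (0 : ℝ) 1).indicator (mapE φ))) s := by
  obtain ⟨L, hL0, hL⟩ := hφ.exists_lipschitz
  have hmeas : AEStronglyMeasurable ((Ioc (0 : ℝ) 1).indicator (mapE φ))
      (volume.restrict (Ioi (0 : ℝ))) :=
    hφ.aestronglyMeasurable_mapE.indicator measurableSet_Ioc
  have hbound : ∀ u ∈ Ioi (0 : ℝ), ‖(Ioc (0 : ℝ) 1).indicator (mapE φ) u‖ ≤ 2 * L := by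
    intro u hu
    by_cases hu1 : u ∈ Ioc (0 : ℝ) 1
    · rw [indicator_of_mem hu1]; exact hφ.norm_mapE_le hL0 hL hu1.1 hu1.2
    · rw [indicator_of_notMem hu1, norm_zero]; positivity
  have hloc : LocallyIntegrableOn ((Ioc (0 : ℝ) 1).indicator (mapE φ)) (Ioi 0) := by
    refine IntegrableOn.locallyIntegrableOn ?_
    have h1 : IntegrableOn ((Ioc (0 : ℝ) 1).indicator (mapE φ)) (Ioc 0 1) := by
      refine ⟨hmeas.mono_measure (Measure.restrict_mono_set _ Ioc_subset_Ioi_self), ?_⟩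
      refine HasFiniteIntegral.restrict_of_bounded (C := 2 * L) measure_Ioc_lt_top ?_
      filter_upwards [ae_restrict_mem measurableSet_Ioc] with u hu using hbound u hu.1
    have h2 : IntegrableOn ((Ioc (0 : ℝ) 1).indicator (mapE φ)) (Ioi 1) :=
      integrableOn_zero.congr_fun (fun u hu ↦ (indicator_of_notMem
        (fun h : u ∈ Ioc (0 : ℝ) 1 ↦ absurd h.2 (not_le.2 hu)) _).symm) measurableSet_Ioi
    rw [← Ioc_union_Ioi_eq_Ioi zero_le_one]
    exact h1.union h2
  have htop : (Ioc (0 : ℝ) 1).indicator (mapE φ) =O[atTop] fun t : ℝ ↦ t ^ (-(s.re + 1)) := by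
    have h0 : (Ioc (0 : ℝ) 1).indicator (mapE φ) =ᶠ[atTop] 0 := by
      filter_upwards [eventually_gt_atTop 1] with t ht
      exact indicator_of_notMem (fun h : t ∈ Ioc (0 : ℝ) 1 ↦ absurd h.2 (not_le.2 ht)) _
    exact (isBigO_zero _ _).congr' h0.symm EventuallyEq.rfl
  have hbot : (Ioc (0 : ℝ) 1).indicator (mapE φ) =O[𝓝[>] 0] fun t : ℝ ↦ t ^ (-(0 : ℝ)) := by
    refine IsBigO.of_bound (2 * L) ?_
    filter_upwards [self_mem_nhdsWithin] with t (ht : 0 < t)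
    simpa [Real.rpow_zero] using hbound t ht
  exact ⟨mellinConvergent_of_isBigO_rpow hloc htop (by linarith) hbot (by simpa using hs),
    mellin_differentiableAt_of_isBigO_rpow hloc htop (by linarith) hbot (by simpa using hs)⟩

/-- For `Re s > 1`: `∫_0^1 E(φ)(u)u^{s−1} du = ζ(s)φ̂(s) − (∫_0^∞φ)/(s−1)` (`E(φ) = T(φ) − c/u` on
`(0,1]`, `T(φ) = 0` on `(1,∞)`, `∫_0^1 u^{s−2} du = 1/(s−1)`).
[cite: Burnol2001, §2 (before Thm 2.7), TeX l.474–480] -/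
theorem mellin_indicator_mapE_eq_of_one_lt_re (hφ : IsTest φ) {s : ℂ} (hs : 1 < s.re) :
    mellin ((Ioc (0 : ℝ) 1).indicator (mapE φ)) s =
      riemannZeta s * mellin φ s - (∫ x in Ioi (0 : ℝ), φ x) / (s - 1) := by
  set c : ℂ := ∫ x in Ioi (0 : ℝ), φ x with hc
  have hsplit : ∀ t ∈ Ioi (0 : ℝ), (t : ℂ) ^ (s - 1) • (Ioc (0 : ℝ) 1).indicator (mapE φ) t =
      (t : ℂ) ^ (s - 1) • mapT φ t -
        (t : ℂ) ^ (s - 1) • (c • (Ioc (0 : ℝ) 1).indicator (fun u : ℝ ↦ (u : ℂ) ^ (-1 : ℂ)) t) := by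
    intro t ht
    have ht0 : (0 : ℝ) < t := ht
    have ht' : (t : ℂ) ≠ 0 := by exact_mod_cast ht0.ne'
    by_cases ht1 : t ≤ 1
    · have hmem : t ∈ Ioc (0 : ℝ) 1 := ⟨ht0, ht1⟩
      rw [indicator_of_mem hmem, indicator_of_mem hmem, mapE, ← hc, mapT, smul_sub, smul_eq_mul,
        smul_eq_mul, smul_eq_mul, smul_eq_mul, cpow_neg_one]
      ring
    · rw [not_le] at ht1
      simp only [indicator_of_notMem (fun h : t ∈ Ioc (0 : ℝ) 1 ↦ absurd h.2 (not_le.2 ht1)),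
        smul_zero, hφ.mapT_eq_zero_of_one_lt ht1, sub_zero]
  have hA : HasMellin ((Ioc (0 : ℝ) 1).indicator (fun u : ℝ ↦ (u : ℂ) ^ (-1 : ℂ))) s (1 / (s - 1)) := by
    have := hasMellin_cpow_Ioc (-1) (s := s) (by simp; linarith)
    simpa [sub_eq_add_neg] using this
  rw [mellin, setIntegral_congr_fun measurableSet_Ioi hsplit,
    integral_sub (hφ.mellinConvergent_mapT hs) (hA.1.const_smul c)]
  have h1 : ∫ t in Ioi (0 : ℝ), (t : ℂ) ^ (s - 1) • mapT φ t = riemannZeta s * mellin φ s := by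
    rw [← hφ.mellin_mapT_eq_of_one_lt_re hs, mellin]
  have h2 : ∫ t in Ioi (0 : ℝ), (t : ℂ) ^ (s - 1) •
      (c • (Ioc (0 : ℝ) 1).indicator (fun u : ℝ ↦ (u : ℂ) ^ (-1 : ℂ)) t) = c • (1 / (s - 1)) := by
    rw [← hA.2, ← mellin_const_smul]
    rfl
  rw [h1, h2, smul_eq_mul]
  ring

/-- **The split continuation**: for `0 < Re s` (any `s`),
`(s−1)·∫_0^1 E(φ)(u)u^{s−1} du + ∫_0^∞ φ = ζ₁(s)φ̂(s)` (`ζ₁(s) = (s−1)ζ(s)` entire): both sides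
are holomorphic on the right half-plane and agree on `Re s > 1`.
[cite: Burnol2001, §2 (before Thm 2.7), TeX l.470–480 ("which remains valid for `Re(s) > 0`")] -/
theorem mellin_indicator_mapE_eq (hφ : IsTest φ) {s : ℂ} (hs : 0 < s.re) :
    (s - 1) * mellin ((Ioc (0 : ℝ) 1).indicator (mapE φ)) s + (∫ x in Ioi (0 : ℝ), φ x) =
      riemannZeta₁ s * mellin φ s := by
  set U : Set ℂ := {z : ℂ | 0 < z.re} with hU
  set f : ℂ → ℂ := fun z ↦ (z - 1) * mellin ((Ioc (0 : ℝ) 1).indicator (mapE φ)) z +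
    (∫ x in Ioi (0 : ℝ), φ x) with hf
  set g : ℂ → ℂ := fun z ↦ riemannZeta₁ z * mellin φ z with hg
  have hUo : IsOpen U := continuous_re.isOpen_preimage _ isOpen_Ioi
  have hfan : AnalyticOnNhd ℂ f U := by
    refine DifferentiableOn.analyticOnNhd (fun z hz ↦ ?_) hUo
    exact (((differentiableAt_id.sub_const 1).mul
      (hφ.hasMellin_indicator_mapE_aux hz).2).add_const _).differentiableWithinAt
  have hgan : AnalyticOnNhd ℂ g U := by
    refine DifferentiableOn.analyticOnNhd (fun z hz ↦ ?_) hUo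
    exact ((differentiable_riemannZeta₁ z).mul (hφ.differentiableAt_mellin hz)).differentiableWithinAt
  have hpre : IsPreconnected U := (convex_halfSpace_re_gt 0).isPreconnected
  have h2 : (2 : ℂ) ∈ U := by simp [hU]
  have hfg : f =ᶠ[𝓝 2] g := by
    have : ∀ᶠ z in 𝓝 (2 : ℂ), 1 < z.re :=
      (continuous_re.isOpen_preimage _ isOpen_Ioi).mem_nhds (by simp)
    filter_upwards [this] with z hz
    have hz1 : z ≠ 1 := fun h ↦ by simp [h] at hz
    have hz2 : z - 1 ≠ 0 := sub_ne_zero.2 hz1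
    simp only [hf, hg, hφ.mellin_indicator_mapE_eq_of_one_lt_re hz, riemannZeta_eq_inv_sub_mul hz1]
    field_simp
    ring
  exact hfan.eqOn_of_preconnected_of_eventuallyEq hgan hpre h2 hfg hs

/-- **`Ê(φ)(s₀) = 0` at a zero `s₀` of `ζ` in the strip `0 < Re s₀ < 1`**: there `E(φ)` is
Mellin-integrable on all of `(0,∞)` ("absolutely convergent … for `0 < Re(s) < 1`"), and
`Ê(φ)(s₀) = ∫_0^1 E(φ)u^{s₀−1} + ∫_1^∞ (−c/u)u^{s₀−1} = −c/(s₀−1) + c/(s₀−1) = 0` by the split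
continuation (`ζ₁(s₀) = (s₀−1)ζ(s₀) = 0`). [cite: Burnol2001, §2 (before Thm 2.7), TeX l.470–480] -/
theorem hasMellin_mapE_zero (hφ : IsTest φ) {s : ℂ} (hs0 : 0 < s.re) (hs1 : s.re < 1)
    (hζ : riemannZeta s = 0) : HasMellin (mapE φ) s 0 := by
  set c : ℂ := ∫ x in Ioi (0 : ℝ), φ x with hc
  have hs2 : s ≠ 1 := fun h ↦ by simp [h] at hs1
  have hs3 : s - 1 ≠ 0 := sub_ne_zero.2 hs2
  -- `E(φ) = 𝟙_{(0,1]}E(φ) − c·𝟙_{(1,∞)} u^{-1}` on `(0,∞)`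
  have hsplit : ∀ t ∈ Ioi (0 : ℝ), (t : ℂ) ^ (s - 1) • mapE φ t =
      (t : ℂ) ^ (s - 1) • (Ioc (0 : ℝ) 1).indicator (mapE φ) t -
        c * (Ioi (1 : ℝ)).indicator (fun u : ℝ ↦ (u : ℂ) ^ (s - 2)) t := by
    intro t ht
    have ht0 : (0 : ℝ) < t := ht
    by_cases ht1 : t ≤ 1
    · have hmem : t ∈ Ioc (0 : ℝ) 1 := ⟨ht0, ht1⟩
      simp only [indicator_of_mem hmem,
        indicator_of_notMem (fun h : t ∈ Ioi (1 : ℝ) ↦ absurd ht1 (not_le.2 h)), mul_zero, sub_zero]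
    · rw [not_le] at ht1
      have ht2 : (t : ℂ) ≠ 0 := by exact_mod_cast ht0.ne'
      rw [indicator_of_notMem (fun h : t ∈ Ioc (0 : ℝ) 1 ↦ absurd h.2 (not_le.2 ht1)), smul_zero,
        zero_sub, indicator_of_mem (show t ∈ Ioi (1 : ℝ) from ht1), hφ.mapE_eq_of_one_lt ht1,
        smul_eq_mul, show s - 2 = (s - 1) + (-1) by ring, cpow_add _ _ ht2, cpow_neg_one, hc]
      field_simp
  have hint2 : Integrable ((Ioi (1 : ℝ)).indicator (fun u : ℝ ↦ (u : ℂ) ^ (s - 2)))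
      (volume.restrict (Ioi 0)) :=
    ((integrableOn_Ioi_cpow_of_lt (by simp; linarith) zero_lt_one).integrable_indicator
      measurableSet_Ioi).restrict
  have hcut := (hφ.hasMellin_indicator_mapE_aux hs0).1
  refine ⟨(hcut.sub (hint2.const_mul c)).congr_fun (fun t ht ↦ (hsplit t ht).symm)
    measurableSet_Ioi, ?_⟩
  rw [mellin, setIntegral_congr_fun measurableSet_Ioi hsplit, integral_sub hcut (hint2.const_mul c),
    integral_const_mul]
  have h1 : ∫ t in Ioi (0 : ℝ), (t : ℂ) ^ (s - 1) • (Ioc (0 : ℝ) 1).indicator (mapE φ) t =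
      -c / (s - 1) := by
    have key := hφ.mellin_indicator_mapE_eq hs0
    have hz : riemannZeta₁ s = 0 := by
      have h := riemannZeta_eq_inv_sub_mul hs2
      rw [hζ] at h
      rcases mul_eq_zero.1 h.symm with h' | h'
      · exact absurd h' (inv_ne_zero hs3)
      · exact h'
    rw [hz, zero_mul] at key
    rw [← mellin]
    have : (s - 1) * mellin ((Ioc (0 : ℝ) 1).indicator (mapE φ)) s = -c := by
      rw [hc]; linear_combination key
    field_simp
    linear_combination this
  have h2 : ∫ t in Ioi (0 : ℝ), (Ioi (1 : ℝ)).indicator (fun u : ℝ ↦ (u : ℂ) ^ (s - 2)) t =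
      -(1 / (s - 1)) := by
    rw [setIntegral_indicator measurableSet_Ioi, Ioi_inter_Ioi]
    norm_num
    rw [integral_Ioi_cpow_of_lt (by simp; linarith) zero_lt_one]
    push_cast
    rw [one_cpow, show s - 2 + 1 = s - 1 by ring]
    ring
  rw [h1, h2]
  field_simp
  ring

/-- **`(VE(φ))^(s₀) = 0` at a zero `s₀` of `ζ` in the strip** — the spectral action of `V`
(`hasMellin_integral_Ioi_div`: multiplier `(s−1)/s`) applied to `E(φ)`.
[cite: Burnol2001, §2 (before Thm 2.7), TeX l.481–496] -/
theorem hasMellin_opV_mapE_zero (hφ : IsTest φ) {s : ℂ} (hs0 : 0 < s.re) (hs1 : s.re < 1)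
    (hζ : riemannZeta s = 0) : HasMellin (opV (mapE φ)) s 0 := by
  have hE := hφ.hasMellin_mapE_zero hs0 hs1 hζ
  have hW := hasMellin_integral_Ioi_div hs0 hφ.aestronglyMeasurable_mapE hE.1
  rw [hE.2, zero_div] at hW
  have h := hasMellin_sub hE.1 hW.1
  rw [hE.2, hW.2, sub_zero] at h
  exact h

end IsTest

end Burnol2001

open Burnol2001

/-! ## The door: `cl V E(𝒮_{≤1}) = ℍ²` ⟹ RH -/

/-- **Burnol 2001, Thm 2.7, the RH-FREE half of the equality clause.** If every `g ∈ ℍ²`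
(square-integrable on `(0,∞)`, a.e. zero on `(1,∞)`) is an `L²((0,∞))`-limit of functions
`V E(φ)`, `φ ∈ 𝒮_{≤1}` — the left-hand side of `Literature.NumberTheory.LFunctions.Burnol2001_thm_2_7_iff`
verbatim — then the Riemann hypothesis holds: with `g = 𝟙_{(0,1]}`, at a zero `s₀` of `ζ` with
`½ < Re s₀ < 1` every `VE(φ)` is Mellin-orthogonal to `u^{s₀−1}` (`hasMellin_opV_mapE_zero`) while
`∫_0^1 u^{s₀−1} du = 1/s₀ ≠ 0`; Cauchy–Schwarz and `ε → 0`; `quasiRiemannHypothesis_one_half_iff_holds`.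
The converse (RH ⟹ density, via the Blaschke product `B(s)` being trivial) is NOT proved here
(boundary F8). [cite: Burnol2001, Thm 2.7 (arXiv v3 l.497–499)] -/
theorem riemannHypothesis_of_opV_mapE_closure
    (h : ∀ g : ℝ → ℂ, InH2 g →
      ∀ ε : ℝ, 0 < ε → ∃ φ : ℝ → ℂ, IsTest φ ∧
        eLpNorm (fun u : ℝ ↦ g u - opV (mapE φ) u) 2 (volume.restrict (Ioi (0 : ℝ))) <
          ENNReal.ofReal ε) :
    RiemannHypothesis := by
  -- specialise to `g = 𝟙_{(0,1]}`
  set χ : ℝ → ℂ := (Ioc (0 : ℝ) 1).indicator fun _ ↦ (1 : ℂ) with hχ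
  have hχm : Measurable χ := measurable_const.indicator measurableSet_Ioc
  have hχH2 : InH2 χ := by
    refine ⟨?_, ?_⟩
    · refine memLp_indicator_const 2 measurableSet_Ioc (1 : ℂ) (Or.inr ?_)
      rw [Measure.restrict_apply measurableSet_Ioc]
      exact ((measure_mono inter_subset_left).trans_lt measure_Ioc_lt_top).ne
    · filter_upwards [ae_restrict_mem measurableSet_Ioi] with u (hu : 1 < u)
      exact indicator_of_notMem (fun h' : u ∈ Ioc (0 : ℝ) 1 ↦ absurd h'.2 (not_le.2 hu)) _
  have h1 := h χ hχH2
  refine quasiRiemannHypothesis_one_half_iff_holds.1 fun s hζ hσ hσ1 ↦ ?_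
  set μ0 : Measure ℝ := volume.restrict (Ioi 0) with hμ0
  have hre : 0 < s.re := by linarith
  have hs0 : s ≠ 0 := fun h0 ↦ by simp [h0] at hre
  -- the test function `g = 𝟙_{(0,1]} x^{s-1}` and its (finite) `L²` norm `M`
  set g : ℝ → ℂ := (Ioc (0 : ℝ) 1).indicator fun x ↦ (x : ℂ) ^ (s - 1) with hg
  have hgm : AEStronglyMeasurable g μ0 := by
    refine (Measurable.indicator ?_ measurableSet_Ioc).aestronglyMeasurable
    exact Complex.measurable_ofReal.pow_const _
  have hgL2 : MemLp g 2 μ0 := by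
    refine (memLp_two_iff_integrable_sq_norm hgm).2 ?_
    have hI : IntegrableOn (fun x : ℝ ↦ x ^ (2 * (s.re - 1))) (Ioc 0 1) μ0 :=
      (intervalIntegral.intervalIntegrable_rpow' (a := 0) (b := 1) (by linarith)).1.restrict
    refine (hI.integrable_indicator measurableSet_Ioc).congr ?_
    filter_upwards [ae_restrict_mem measurableSet_Ioi] with x (hx : 0 < x)
    by_cases hx1 : x ∈ Ioc (0 : ℝ) 1
    · simp only [hg, indicator_of_mem hx1, norm_cpow_eq_rpow_re_of_pos hx, sub_re, one_re]
      rw [← Real.rpow_natCast, ← Real.rpow_mul hx.le]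
      norm_num [mul_comm]
    · simp [hg, indicator_of_notMem hx1]
  set M : ℝ := (eLpNorm g 2 μ0).toReal with hM
  have hM0 : 0 ≤ M := ENNReal.toReal_nonneg
  -- Key estimate: for every `ε > 0`, `‖1/s‖ ≤ ε M`.
  have key : ∀ ε : ℝ, 0 < ε → ‖(1 : ℂ) / s‖ ≤ ε * M := by
    intro ε hε
    obtain ⟨φ, hφ, hN⟩ := h1 ε hε
    set D : ℝ → ℂ := fun u ↦ χ u - opV (mapE φ) u with hD
    have hDm : AEStronglyMeasurable D μ0 :=
      hχm.aestronglyMeasurable.sub hφ.aestronglyMeasurable_opV_mapE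
    -- `D` vanishes on `(1,∞)`
    have hD1 : ∀ x : ℝ, 1 < x → D x = 0 := by
      intro x hx
      simp only [hD, hχ, indicator_of_notMem (fun h' : x ∈ Ioc (0 : ℝ) 1 ↦ absurd h'.2 (not_le.2 hx)),
        hφ.opV_mapE_eq_zero hx, sub_zero]
    ------------------------------------------------------------------
    -- (i) the pairing with `x^{s-1}` on `(0,∞)` equals `1/s`
    ------------------------------------------------------------------
    have hmel : HasMellin (opV (mapE φ)) s 0 := hφ.hasMellin_opV_mapE_zero hre hσ1 hζ
    have hI : ∫ x in Ioi (0 : ℝ), (x : ℂ) ^ (s - 1) • D x = 1 / s := by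
      have hint1 : Integrable (fun x : ℝ ↦ (x : ℂ) ^ (s - 1) • χ x) μ0 := (hasMellin_one_Ioc hre).1
      simp only [hD, smul_sub]
      rw [integral_sub hint1 hmel.1]
      have e1 : ∫ x in Ioi (0 : ℝ), (x : ℂ) ^ (s - 1) • χ x = 1 / s := (hasMellin_one_Ioc hre).2
      have e2 : ∫ x in Ioi (0 : ℝ), (x : ℂ) ^ (s - 1) • opV (mapE φ) x = 0 := hmel.2
      rw [e1, e2, sub_zero]
    ------------------------------------------------------------------
    -- (ii) Cauchy–Schwarz: the pairing has norm `≤ ε M`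
    ------------------------------------------------------------------
    have hIle : ‖∫ x in Ioi (0 : ℝ), (x : ℂ) ^ (s - 1) • D x‖ ≤ ε * M := by
      have hprod : ∀ x ∈ Ioi (0 : ℝ), (x : ℂ) ^ (s - 1) • D x = (D • g) x := by
        intro x hx
        simp only [Pi.smul_apply', smul_eq_mul, hg]
        by_cases hx1 : x ∈ Ioc (0 : ℝ) 1
        · simp only [indicator_of_mem hx1]; ring
        · have hx1' : 1 < x := by
            rw [mem_Ioc, not_and, not_le] at hx1; exact hx1 hx
          simp only [indicator_of_notMem hx1, mul_zero, hD1 x hx1']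
      have hH : eLpNorm (D • g) 1 μ0 ≤ ENNReal.ofReal ε * eLpNorm g 2 μ0 :=
        (eLpNorm_smul_le_mul_eLpNorm hgm hDm).trans (by gcongr)
      have hfin : ENNReal.ofReal ε * eLpNorm g 2 μ0 ≠ ⊤ :=
        ENNReal.mul_ne_top ENNReal.ofReal_ne_top hgL2.eLpNorm_lt_top.ne
      calc ‖∫ x in Ioi (0 : ℝ), (x : ℂ) ^ (s - 1) • D x‖
          = ‖∫ x in Ioi (0 : ℝ), (D • g) x‖ := by rw [setIntegral_congr_fun measurableSet_Ioi hprod]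
        _ ≤ (∫⁻ x in Ioi (0 : ℝ), ENNReal.ofReal ‖(D • g) x‖).toReal :=
            norm_integral_le_lintegral_norm _
        _ = (eLpNorm (D • g) 1 μ0).toReal := by
            rw [eLpNorm_one_eq_lintegral_enorm]
            simp_rw [ofReal_norm]
            rfl
        _ ≤ (ENNReal.ofReal ε * eLpNorm g 2 μ0).toReal := ENNReal.toReal_mono hfin hH
        _ = ε * M := by rw [ENNReal.toReal_mul, ENNReal.toReal_ofReal hε.le]
    rw [← hI]
    exact hIle
  -- Conclusion: `‖1/s‖ = 0`, absurd.
  have hpos : 0 < ‖(1 : ℂ) / s‖ := norm_pos_iff.2 (one_div_ne_zero hs0)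
  have := key (‖(1 : ℂ) / s‖ / (2 * (M + 1))) (by positivity)
  have hlt : ‖(1 : ℂ) / s‖ / (2 * (M + 1)) * M < ‖(1 : ℂ) / s‖ := by
    rw [div_mul_eq_mul_div, div_lt_iff₀ (by positivity)]
    nlinarith
  linarith

/-- The same door phrased on the named fact: the left-hand side of `Burnol2001_thm_2_7_iff`
implies `RiemannHypothesis` (so the fact's content beyond the tree theorems
`Burnol2001_thm_2_7_subset_holds` and this one is exactly its `RH ⟹ equality` half).
[cite: Burnol2001, Thm 2.7 (arXiv v3 l.497–499)] -/
theorem Burnol2001_thm_2_7_iff_mp :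
    (∀ g : ℝ → ℂ, InH2 g →
      ∀ ε : ℝ, 0 < ε → ∃ φ : ℝ → ℂ, IsTest φ ∧
        eLpNorm (fun u : ℝ ↦ g u - opV (mapE φ) u) 2 (volume.restrict (Ioi (0 : ℝ))) <
          ENNReal.ofReal ε) → RiemannHypothesis :=
  riemannHypothesis_of_opV_mapE_closure

namespace Burnol2001

/-! ## The `RH ⟹ cl V E(𝒮_{≤1}) = ℍ²` half — an elementary road

Burnol's printed proof of this half goes through the Beurling–Lax description of the
dilation-invariant subspaces of `ℍ²` and the outer factor of `(s−1)ζ(s)/s²` (Thm 2.4); that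
theory is absent from Mathlib.  DEVIATION (shorter road, same statement): we use the already
PROVED periodization criterion Thm 2.6 (`periodization_closure_of_riemannHypothesis`): under RH
the constant `1` is an `L²(0,1)`-limit of periodizations `T(ψ)`, `ψ ∈ 𝒮⁰_{≤1}`; the space
`T(𝒮⁰_{≤1})` is stable under the contractions `u ↦ u/λ`, `0 < λ ≤ 1`, and under linear
combinations, so it approximates every `Ioc`-step function and hence (uniform continuity of
compactly supported continuous functions, which are `L²`-dense) all of `L²(0,1)`; finally the
EXACT IDENTITY `V E(φ̃) = T(ψ)` on `(0,∞)` for `φ̃ = ψ̃ − H(ψ̃) ∈ 𝒮_{≤1}`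
(`ψ̃(x) = ψ(x) + ψ(−x)`, `H(ψ̃)(x) = ∫_0^1 ψ̃(xσ) dσ`; Burnol's "`V = 1 − M`, `M : u^{s−1} ↦ u^{s−1}/s`"
made explicit by one application of the fundamental theorem of calculus to
`w ↦ (1/w)∫_0^w ψ`, whose derivative is `φ̃(w)/w`) puts `T(𝒮⁰_{≤1})` inside `V E(𝒮_{≤1})`. -/

namespace IsTest0

variable {ψ : ℝ → ℂ}

/-- `ψ(0) = 0` for `ψ ∈ 𝒮⁰_{≤1}` (continuity; `ψ = 0` on `(−∞,0)`).
[cite: Burnol2001, §2 (before Thm 2.6)] -/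
theorem map_zero (hψ : IsTest0 ψ) : ψ 0 = 0 := by
  have h1 : Tendsto ψ (𝓝[<] (0 : ℝ)) (𝓝 (ψ 0)) :=
    hψ.continuous.continuousAt.tendsto.mono_left nhdsWithin_le_nhds
  have h2 : Tendsto ψ (𝓝[<] (0 : ℝ)) (𝓝 0) := by
    refine tendsto_const_nhds.congr' ?_
    filter_upwards [self_mem_nhdsWithin] with x (hx : x < 0) using (hψ.eq_zero_of_neg hx).symm
  exact tendsto_nhds_unique h1 h2

/-- `ψ(x) = 0` for `x ≤ 0`. [cite: Burnol2001, §2 (before Thm 2.6)] -/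
theorem eq_zero_of_nonpos (hψ : IsTest0 ψ) {x : ℝ} (hx : x ≤ 0) : ψ x = 0 := by
  rcases hx.lt_or_eq with h | h
  · exact hψ.eq_zero_of_neg h
  · rw [h]; exact hψ.map_zero

/-- `∫_0^x ψ = 0` for `x ≥ 1`. [cite: Burnol2001, §2 (before Thm 2.6)] -/
theorem intervalIntegral_eq_zero_of_one_le (hψ : IsTest0 ψ) {x : ℝ} (hx : 1 ≤ x) :
    ∫ w in (0 : ℝ)..x, ψ w = 0 := by
  rw [← hψ.integral_Ioi_eq hx, hψ.integral_Ioi_eq_zero]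

/-- The average `H(ψ)(x) = ∫_0^1 ψ(xσ) dσ = x^{-1}∫_0^x ψ` (`x ≠ 0`).
[cite: Burnol2001, §2 (before Thm 2.7)] -/
theorem average_eq (ψ : ℝ → ℂ) {x : ℝ} (hx : x ≠ 0) :
    ∫ σ in (0 : ℝ)..1, ψ (x * σ) = (x⁻¹ : ℝ) • ∫ w in (0 : ℝ)..x, ψ w := by
  have := intervalIntegral.integral_comp_mul_left ψ hx (a := 0) (b := 1)
  simpa using this

/-- `H(ψ)(x) = 0` for `x ≥ 1` (because `∫_0^1 ψ = 0`). [cite: Burnol2001, §2 (before Thm 2.7)] -/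
theorem average_eq_zero_of_one_le (hψ : IsTest0 ψ) {x : ℝ} (hx : 1 ≤ x) :
    ∫ σ in (0 : ℝ)..1, ψ (x * σ) = 0 := by
  rw [average_eq ψ (by positivity), hψ.intervalIntegral_eq_zero_of_one_le hx, smul_zero]

/-- `∫_0^1 ψ(−xσ) dσ = 0` for `x ≥ 0`. [cite: Burnol2001, §2 (before Thm 2.7)] -/
theorem average_neg_eq_zero (hψ : IsTest0 ψ) {x : ℝ} (hx : 0 ≤ x) :
    ∫ σ in (0 : ℝ)..1, ψ (-(x * σ)) = 0 := by
  have : ∀ σ ∈ uIcc (0 : ℝ) 1, ψ (-(x * σ)) = (fun _ ↦ (0 : ℂ)) σ := by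
    intro σ hσ
    rw [uIcc_of_le zero_le_one] at hσ
    exact hψ.eq_zero_of_nonpos (by nlinarith [hσ.1])
  rw [intervalIntegral.integral_congr this, intervalIntegral.integral_zero]

/-- `H(ψ)` is smooth (differentiation under the integral sign).
[cite: Burnol2001, §2 (before Thm 2.7)] -/
theorem contDiff_average (hψ : IsTest0 ψ) :
    ContDiff ℝ ∞ (fun y : ℝ ↦ ∫ σ in (0 : ℝ)..1, ψ (y * σ)) :=
  Literature.Analysis.FunctionSpaces.contDiff_parametric_intervalIntegral_comp hψ.1
    (A := fun q : ℝ × ℝ ↦ q.2 * q.1) (contDiff_snd.mul contDiff_fst) 0 1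

/-- For `w > 0`: `H(ψ)'(w) = (ψ(w) − H(ψ)(w))/w`. [cite: Burnol2001, §2 (before Thm 2.7)] -/
theorem hasDerivAt_average (hψ : IsTest0 ψ) {w : ℝ} (hw : 0 < w) :
    HasDerivAt (fun y : ℝ ↦ ∫ σ in (0 : ℝ)..1, ψ (y * σ))
      ((w⁻¹ : ℝ) • (ψ w - ∫ σ in (0 : ℝ)..1, ψ (w * σ))) w := by
  have hG : HasDerivAt (fun y : ℝ ↦ ∫ t in (0 : ℝ)..y, ψ t) (ψ w) w :=
    intervalIntegral.integral_hasDerivAt_right (hψ.intervalIntegrable 0 w)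
      (hψ.continuous.stronglyMeasurableAtFilter _ _) hψ.continuous.continuousAt
  have hinv : HasDerivAt (fun y : ℝ ↦ y⁻¹) (-(w ^ 2)⁻¹) w := hasDerivAt_inv hw.ne'
  have h := hinv.smul hG
  have heq : (fun y : ℝ ↦ y⁻¹ • ∫ t in (0 : ℝ)..y, ψ t) =ᶠ[𝓝 w]
      fun y : ℝ ↦ ∫ σ in (0 : ℝ)..1, ψ (y * σ) := by
    filter_upwards [Ioi_mem_nhds hw] with y (hy : 0 < y) using (average_eq ψ hy.ne').symm
  refine (h.congr_of_eventuallyEq heq.symm).congr_deriv ?_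
  rw [average_eq ψ hw.ne', smul_sub, smul_smul]
  have e : (-(w ^ 2)⁻¹ : ℝ) = -(w⁻¹ * w⁻¹) := by rw [pow_two, mul_inv]
  rw [e, neg_smul, ← sub_eq_add_neg]

/-- FTC: `∫_a^b (ψ(w) − H(ψ)(w)) dw/w = H(ψ)(b) − H(ψ)(a)` for `0 < a ≤ b`.
[cite: Burnol2001, §2 (before Thm 2.7)] -/
theorem integral_sub_average_div_eq (hψ : IsTest0 ψ) {a b : ℝ} (ha : 0 < a) (hab : a ≤ b) :
    ∫ w in a..b, (ψ w - ∫ σ in (0 : ℝ)..1, ψ (w * σ)) / (w : ℂ) =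
      (∫ σ in (0 : ℝ)..1, ψ (b * σ)) - ∫ σ in (0 : ℝ)..1, ψ (a * σ) := by
  have hH : Continuous (fun y : ℝ ↦ ∫ σ in (0 : ℝ)..1, ψ (y * σ)) := hψ.contDiff_average.continuous
  apply intervalIntegral.integral_eq_sub_of_hasDerivAt
  · intro w hw
    rw [uIcc_of_le hab] at hw
    have hw0 : 0 < w := ha.trans_le hw.1
    refine (hψ.hasDerivAt_average hw0).congr_deriv ?_
    rw [Complex.real_smul, ofReal_inv, div_eq_inv_mul]
  · apply ContinuousOn.intervalIntegrable
    rw [uIcc_of_le hab]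
    refine ContinuousOn.div ((hψ.continuous.sub hH).continuousOn)
      continuous_ofReal.continuousOn fun w hw ↦ ?_
    exact_mod_cast (ha.trans_le hw.1).ne'

/-- For `y ≥ 0` the odd reflections drop out:
`φ̃(y) = ψ(y) − H(ψ)(y)` with `φ̃(x) = ψ(x) + ψ(−x) − ∫_0^1 (ψ(xσ) + ψ(−xσ)) dσ`, `y > 0`.
[cite: Burnol2001, §2 (before Thm 2.7)] -/
theorem tilde_apply_of_pos (hψ : IsTest0 ψ) {y : ℝ} (hy : 0 < y) :
    ψ y + ψ (-y) - ∫ σ in (0 : ℝ)..1, (ψ (y * σ) + ψ (-(y * σ))) =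
      ψ y - ∫ σ in (0 : ℝ)..1, ψ (y * σ) := by
  have h1 : IntervalIntegrable (fun σ : ℝ ↦ ψ (y * σ)) volume 0 1 :=
    (hψ.continuous.comp (continuous_const.mul continuous_id)).intervalIntegrable 0 1
  have h2 : IntervalIntegrable (fun σ : ℝ ↦ ψ (-(y * σ))) volume 0 1 :=
    (hψ.continuous.comp (continuous_const.mul continuous_id).neg).intervalIntegrable 0 1
  rw [hψ.eq_zero_of_neg (by linarith : -y < 0), add_zero, intervalIntegral.integral_add h1 h2,
    hψ.average_neg_eq_zero hy.le, add_zero]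

/-- `φ̃` vanishes on `(1, ∞)`. [cite: Burnol2001, §2 (before Thm 2.7)] -/
theorem tilde_eq_zero_of_one_lt (hψ : IsTest0 ψ) {y : ℝ} (hy : 1 < y) :
    ψ y + ψ (-y) - ∫ σ in (0 : ℝ)..1, (ψ (y * σ) + ψ (-(y * σ))) = 0 := by
  rw [hψ.tilde_apply_of_pos (by linarith), hψ.eq_zero_of_one_lt hy,
    hψ.average_eq_zero_of_one_le hy.le, sub_zero]

/-- `φ̃` is even. [cite: Burnol2001, §2 (before Thm 2.7)] -/
theorem tilde_neg (ψ : ℝ → ℂ) (x : ℝ) :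
    ψ (-x) + ψ (-(-x)) - ∫ σ in (0 : ℝ)..1, (ψ ((-x) * σ) + ψ (-((-x) * σ))) =
      ψ x + ψ (-x) - ∫ σ in (0 : ℝ)..1, (ψ (x * σ) + ψ (-(x * σ))) := by
  rw [neg_neg, add_comm (ψ (-x))]
  congr 1
  refine intervalIntegral.integral_congr fun σ _ ↦ ?_
  simp only [neg_mul, neg_neg]
  exact add_comm _ _

/-- **`φ̃ ∈ 𝒮_{≤1}`** for `ψ ∈ 𝒮⁰_{≤1}`: smooth (differentiation under the integral sign), even,
supported in `[−1,1]` (`H(ψ)(y) = y^{-1}∫_0^1 ψ = 0` for `y ≥ 1`).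
[cite: Burnol2001, §2 (before Thm 2.7)] -/
theorem isTest_tilde (hψ : IsTest0 ψ) :
    IsTest (fun x : ℝ ↦ ψ x + ψ (-x) - ∫ σ in (0 : ℝ)..1, (ψ (x * σ) + ψ (-(x * σ)))) := by
  refine ⟨?_, fun x ↦ tilde_neg ψ x, ?_⟩
  · have hG : ContDiff ℝ ∞ (fun y : ℝ ↦ ψ y + ψ (-y)) := hψ.1.add (hψ.1.comp contDiff_neg)
    have hI := Literature.Analysis.FunctionSpaces.contDiff_parametric_intervalIntegral_comp hG
      (A := fun q : ℝ × ℝ ↦ q.2 * q.1) (contDiff_snd.mul contDiff_fst) 0 1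
    exact hG.sub hI
  · intro x hx
    rw [Function.mem_support] at hx
    by_contra hx'
    apply hx
    rcases lt_or_ge 1 x with h1 | h1
    · exact hψ.tilde_eq_zero_of_one_lt h1
    · have h2 : x < -1 := by
        by_contra h2
        exact hx' ⟨not_lt.1 h2, h1⟩
      rw [← tilde_neg ψ x]
      have := hψ.tilde_eq_zero_of_one_lt (y := -x) (by linarith)
      simpa only [neg_neg] using this

end IsTest0

namespace IsTest

variable {φ : ℝ → ℂ}

/-- `V` kills `c/u`: `c/u − ∫_u^∞ c v^{−2} dv = 0` (`u > 0`) — the factor `(s−1)/s` vanishes at the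
pole `s = 1` of `c/(s−1)`. [cite: Burnol2001, §2 (before Thm 2.7), TeX l.484–487] -/
theorem opV_const_div_eq_zero (c : ℂ) {u : ℝ} (hu : 0 < u) :
    opV (fun v : ℝ ↦ c / (v : ℂ)) u = 0 := by
  have hpt : ∀ v ∈ Ioi u, c / (v : ℂ) / (v : ℂ) = c * ((v ^ (-2 : ℝ) : ℝ) : ℂ) := by
    intro v hv
    have hv0 : (0 : ℝ) < v := hu.trans hv
    have hv' : (v : ℂ) ≠ 0 := by exact_mod_cast hv0.ne'
    rw [Real.rpow_neg hv0.le, show (2 : ℝ) = (2 : ℕ) by norm_num, Real.rpow_natCast]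
    push_cast
    field_simp
  rw [opV, setIntegral_congr_fun measurableSet_Ioi hpt, MeasureTheory.integral_const_mul,
    integral_complex_ofReal, integral_Ioi_rpow_of_lt (by norm_num) hu]
  have : -u ^ ((-2 : ℝ) + 1) / ((-2 : ℝ) + 1) = u⁻¹ := by
    rw [show (-2 : ℝ) + 1 = -1 by norm_num, Real.rpow_neg_one]; ring
  rw [this]
  have hu' : (u : ℂ) ≠ 0 := by exact_mod_cast hu.ne'
  push_cast
  field_simp
  ring

/-- `v ↦ T(φ)(v)/v` is integrable on `(u, ∞)`, `u > 0` (continuous on `[u,1]`, zero beyond `1`).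
[cite: Burnol2001, §2 (before Thm 2.7)] -/
theorem integrableOn_mapT_div (hφ : IsTest φ) {u : ℝ} (hu : 0 < u) :
    IntegrableOn (fun v : ℝ ↦ mapT φ v / (v : ℂ)) (Ioi u) := by
  have h1 : IntegrableOn (fun v : ℝ ↦ mapT φ v / (v : ℂ)) (Ioc u 1) := by
    have hc : ContinuousOn (fun v : ℝ ↦ mapT φ v / (v : ℂ)) (Icc u 1) :=
      ContinuousOn.div (hφ.continuousOn_mapT.mono fun x hx ↦ lt_of_lt_of_le hu hx.1)
        continuous_ofReal.continuousOn fun x hx ↦ by exact_mod_cast (hu.trans_le hx.1).ne'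
    exact hc.integrableOn_Icc.mono_set Ioc_subset_Icc_self
  have h2 : IntegrableOn (fun v : ℝ ↦ mapT φ v / (v : ℂ)) (Ioi 1) := by
    have hz : IntegrableOn (fun _ : ℝ ↦ (0 : ℂ)) (Ioi (1 : ℝ)) := integrableOn_zero
    refine hz.congr_fun (fun v hv ↦ ?_) measurableSet_Ioi
    rw [hφ.mapT_eq_zero_of_one_lt hv, zero_div]
  by_cases hu1 : u ≤ 1
  · rw [← Ioc_union_Ioi_eq_Ioi hu1]
    exact h1.union h2
  · exact h2.mono_set (Ioi_subset_Ioi (not_le.1 hu1).le)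

/-- `V E(φ) = V T(φ)`: `E(φ) = T(φ) − c/u` and `V(c/u) = 0`.
[cite: Burnol2001, §2 (before Thm 2.7), TeX l.484–491] -/
theorem opV_mapE_eq_opV_mapT (hφ : IsTest φ) {u : ℝ} (hu : 0 < u) :
    opV (mapE φ) u = mapT φ u - ∫ v in Ioi u, mapT φ v / (v : ℂ) := by
  set c : ℂ := ∫ x in Ioi (0 : ℝ), φ x with hc
  have hE : mapE φ = fun v ↦ mapT φ v - c / (v : ℂ) := by
    funext v; rfl
  have hint2 : IntegrableOn (fun v : ℝ ↦ c / (v : ℂ) / (v : ℂ)) (Ioi u) := by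
    have : IntegrableOn (fun v : ℝ ↦ c * ((v ^ (-2 : ℝ) : ℝ) : ℂ)) (Ioi u) :=
      ((integrableOn_Ioi_rpow_of_lt (by norm_num) hu).ofReal).const_mul _
    refine this.congr_fun (fun v hv ↦ ?_) measurableSet_Ioi
    have hv0 : (0 : ℝ) < v := hu.trans hv
    have hv' : (v : ℂ) ≠ 0 := by exact_mod_cast hv0.ne'
    show c * ((v ^ (-2 : ℝ) : ℝ) : ℂ) = c / (v : ℂ) / (v : ℂ)
    rw [Real.rpow_neg hv0.le, show (2 : ℝ) = (2 : ℕ) by norm_num, Real.rpow_natCast]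
    push_cast
    field_simp
  have hV0 := opV_const_div_eq_zero c hu
  simp only [opV] at hV0 ⊢
  rw [hE]
  simp only [sub_div]
  rw [integral_sub (hφ.integrableOn_mapT_div hu) hint2]
  linear_combination -hV0

/-- For `0 < u ≤ 1`, `M ≥ 1/u`: `∫_u^∞ T(φ)(v) dv/v = Σ_{n<M} ∫_u^1 φ((n+1)v) dv/v`.
[cite: Burnol2001, §2 (before Thm 2.7)] -/
theorem integral_mapT_div_eq_sum (hφ : IsTest φ) {u : ℝ} (hu : 0 < u) (hu1 : u ≤ 1) {M : ℕ}
    (hM : 1 / u ≤ M) :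
    ∫ v in Ioi u, mapT φ v / (v : ℂ) =
      ∑ n ∈ Finset.range M, ∫ v in u..1, φ ((n + 1 : ℕ) * v) / (v : ℂ) := by
  have h1 : ∫ v in Ioi u, mapT φ v / (v : ℂ) = ∫ v in Ioc u 1, mapT φ v / (v : ℂ) := by
    refine setIntegral_eq_of_subset_of_forall_sdiff_eq_zero measurableSet_Ioi Ioc_subset_Ioi_self
      fun v hv ↦ ?_
    have hv1 : 1 < v := by
      rcases hv with ⟨hv, hv'⟩
      by_contra h
      exact hv' ⟨hv, not_lt.1 h⟩
    rw [hφ.mapT_eq_zero_of_one_lt hv1, zero_div]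
  have hpt : ∀ v ∈ uIcc u 1, mapT φ v / (v : ℂ) =
      ∑ n ∈ Finset.range M, φ ((n + 1 : ℕ) * v) / (v : ℂ) := by
    intro v hv
    rw [uIcc_of_le hu1] at hv
    have hv0 : 0 < v := hu.trans_le hv.1
    have hvM : 1 / v ≤ M := le_trans (one_div_le_one_div_of_le hu hv.1) hM
    rw [mapT, hφ.tsum_eq_sum_range hv0 hvM, Finset.sum_div]
  have hint : ∀ n ∈ Finset.range M,
      IntervalIntegrable (fun v : ℝ ↦ φ ((n + 1 : ℕ) * v) / (v : ℂ)) volume u 1 := by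
    intro n _
    apply ContinuousOn.intervalIntegrable
    rw [uIcc_of_le hu1]
    refine ContinuousOn.div (hφ.continuous.comp (continuous_const.mul continuous_id)).continuousOn
      continuous_ofReal.continuousOn fun v hv ↦ ?_
    exact_mod_cast (hu.trans_le hv.1).ne'
  rw [h1, ← intervalIntegral.integral_of_le hu1, intervalIntegral.integral_congr hpt,
    intervalIntegral.integral_finsetSum hint]

/-- **`V E(φ)` as a finite sum** (`0 < u ≤ 1`, `M ≥ 1/u`):
`V E(φ)(u) = Σ_{n<M} φ((n+1)u) − Σ_{n<M} ∫_{(n+1)u}^{n+1} φ(w) dw/w`.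
[cite: Burnol2001, §2 (before Thm 2.7)] -/
theorem opV_mapE_eq_sum (hφ : IsTest φ) {u : ℝ} (hu : 0 < u) (hu1 : u ≤ 1) {M : ℕ}
    (hM : 1 / u ≤ M) :
    opV (mapE φ) u = ∑ n ∈ Finset.range M, φ ((n + 1 : ℕ) * u) -
      ∑ n ∈ Finset.range M, ∫ w in ((n + 1 : ℕ) : ℝ) * u..((n + 1 : ℕ) : ℝ) * 1, φ w / (w : ℂ) := by
  rw [hφ.opV_mapE_eq_opV_mapT hu, mapT, hφ.tsum_eq_sum_range hu hM,
    hφ.integral_mapT_div_eq_sum hu hu1 hM]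
  congr 1
  refine Finset.sum_congr rfl fun n _ ↦ ?_
  have hn : ((n + 1 : ℕ) : ℝ) ≠ 0 := by positivity
  rw [← intervalIntegral.smul_integral_comp_mul_left (fun w : ℝ ↦ φ w / (w : ℂ)),
    ← intervalIntegral.integral_smul]
  refine intervalIntegral.integral_congr fun v _ ↦ ?_
  show φ ((n + 1 : ℕ) * v) / (v : ℂ) =
    ((n + 1 : ℕ) : ℝ) • (φ (((n + 1 : ℕ) : ℝ) * v) / ((((n + 1 : ℕ) : ℝ) * v : ℝ) : ℂ))
  rw [Complex.real_smul]
  by_cases hv : v = 0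
  · subst hv; simp
  · have hv' : (v : ℂ) ≠ 0 := by exact_mod_cast hv
    have hn' : (((n + 1 : ℕ) : ℝ) : ℂ) ≠ 0 := by exact_mod_cast hn
    push_cast
    field_simp

end IsTest

namespace IsTest0

variable {ψ : ℝ → ℂ}

/-- **The exact identity `V E(φ̃) = T(ψ)` on `(0, ∞)`** for `ψ ∈ 𝒮⁰_{≤1}` and
`φ̃ = ψ̃ − H(ψ̃) ∈ 𝒮_{≤1}`: by `opV_mapE_eq_sum`, the substitution `w = (n+1)v` and the FTC
`∫_{(n+1)u}^{n+1} φ̃(w) dw/w = H(ψ)(n+1) − H(ψ)((n+1)u) = −H(ψ)((n+1)u)`, the `H`-terms cancel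
and `V E(φ̃)(u) = Σ_{n<M} ψ((n+1)u) = T(ψ)(u)`; both sides vanish for `u > 1`. Consequently
`T(𝒮⁰_{≤1}) ⊂ V E(𝒮_{≤1})` as functions on `(0,∞)`. [cite: Burnol2001, §2 (Thm 2.6 ⟹ Thm 2.7)] -/
theorem opV_mapE_tilde_eq (hψ : IsTest0 ψ) {u : ℝ} (hu : 0 < u) :
    opV (mapE (fun x : ℝ ↦ ψ x + ψ (-x) - ∫ σ in (0 : ℝ)..1, (ψ (x * σ) + ψ (-(x * σ))))) u =
      mapT ψ u := by
  have hΦ := hψ.isTest_tilde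
  by_cases hu1 : 1 < u
  · rw [hΦ.opV_mapE_eq_zero hu1, hψ.mapT_eq_zero_of_one_lt hu1]
  push Not at hu1
  have hM : 1 / u ≤ (⌈1 / u⌉₊ : ℕ) := Nat.le_ceil _
  rw [hΦ.opV_mapE_eq_sum hu hu1 hM, hψ.mapT_eq_sum_range hu hM, ← Finset.sum_sub_distrib]
  refine Finset.sum_congr rfl fun n _ ↦ ?_
  have hn1 : (1 : ℝ) ≤ ((n + 1 : ℕ) : ℝ) := by exact_mod_cast Nat.succ_le_succ (Nat.zero_le n)
  have hn0 : (0 : ℝ) < ((n + 1 : ℕ) : ℝ) := by positivity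
  have ha : 0 < ((n + 1 : ℕ) : ℝ) * u := mul_pos hn0 hu
  have hab : ((n + 1 : ℕ) : ℝ) * u ≤ ((n + 1 : ℕ) : ℝ) * 1 :=
    mul_le_mul_of_nonneg_left hu1 hn0.le
  have hcongr : ∀ w ∈ uIcc (((n + 1 : ℕ) : ℝ) * u) (((n + 1 : ℕ) : ℝ) * 1),
      (ψ w + ψ (-w) - ∫ σ in (0 : ℝ)..1, (ψ (w * σ) + ψ (-(w * σ)))) / (w : ℂ) =
        (ψ w - ∫ σ in (0 : ℝ)..1, ψ (w * σ)) / (w : ℂ) := by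
    intro w hw
    rw [uIcc_of_le hab] at hw
    rw [hψ.tilde_apply_of_pos (ha.trans_le hw.1)]
  rw [intervalIntegral.integral_congr hcongr, hψ.integral_sub_average_div_eq ha hab, mul_one,
    hψ.average_eq_zero_of_one_le hn1, hψ.tilde_apply_of_pos ha]
  ring

/-- Packaging: every periodization `T(ψ)`, `ψ ∈ 𝒮⁰_{≤1}`, IS a function `V E(φ)`, `φ ∈ 𝒮_{≤1}`,
on `(0,∞)`. [cite: Burnol2001, §2 (Thm 2.6 ⟹ Thm 2.7)] -/
theorem exists_isTest_opV_mapE_eq (hψ : IsTest0 ψ) :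
    ∃ φ : ℝ → ℂ, IsTest φ ∧ ∀ u : ℝ, 0 < u → opV (mapE φ) u = mapT ψ u :=
  ⟨_, hψ.isTest_tilde, fun _ hu ↦ hψ.opV_mapE_tilde_eq hu⟩

end IsTest0

end Burnol2001

namespace Burnol2001

/-! ## Under RH, `T(𝒮⁰_{≤1})` is dense in `L²(0,1)` (Thm 2.6 + dilations + step functions) -/

namespace IsTest0

variable {ψ ψ₁ ψ₂ : ℝ → ℂ}

/-- `0 ∈ 𝒮⁰_{≤1}`. [cite: Burnol2001, §2 (before Thm 2.6)] -/
theorem zero : IsTest0 (fun _ : ℝ ↦ (0 : ℂ)) :=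
  ⟨contDiff_const, by simp, by simp⟩

/-- `𝒮⁰_{≤1}` is stable under addition. [cite: Burnol2001, §2 (before Thm 2.6)] -/
theorem add (h₁ : IsTest0 ψ₁) (h₂ : IsTest0 ψ₂) : IsTest0 (fun x ↦ ψ₁ x + ψ₂ x) := by
  refine ⟨h₁.1.add h₂.1, ?_, ?_⟩
  · intro x hx
    rw [Function.mem_support] at hx
    by_contra hx'
    apply hx
    have e1 : ψ₁ x = 0 := by
      by_contra h; exact hx' (h₁.2.1 (Function.mem_support.2 h))
    have e2 : ψ₂ x = 0 := by
      by_contra h; exact hx' (h₂.2.1 (Function.mem_support.2 h))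
    rw [e1, e2, add_zero]
  · rw [integral_add (h₁.continuous.integrableOn_Icc) (h₂.continuous.integrableOn_Icc), h₁.2.2,
      h₂.2.2, add_zero]

/-- `𝒮⁰_{≤1}` is stable under scalars. [cite: Burnol2001, §2 (before Thm 2.6)] -/
theorem const_mul (hψ : IsTest0 ψ) (c : ℂ) : IsTest0 (fun x ↦ c * ψ x) := by
  refine ⟨contDiff_const.mul hψ.1, ?_, ?_⟩
  · exact (Function.support_mul_subset_right _ _).trans hψ.2.1
  · rw [MeasureTheory.integral_const_mul, hψ.2.2, mul_zero]

/-- `𝒮⁰_{≤1}` is stable under the contractions `ψ ↦ ψ(·/λ)`, `0 < λ ≤ 1`.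
[cite: Burnol2001, §2 (before Thm 2.6)] -/
theorem comp_div (hψ : IsTest0 ψ) {lam : ℝ} (hlam : 0 < lam) (hlam1 : lam ≤ 1) :
    IsTest0 (fun x ↦ ψ (x / lam)) := by
  refine ⟨hψ.1.comp (contDiff_id.div_const lam), ?_, ?_⟩
  · intro x hx
    rw [Function.mem_support] at hx
    have hx' : x / lam ∈ Icc (0 : ℝ) 1 := hψ.2.1 (Function.mem_support.2 hx)
    constructor
    · have := hx'.1; rwa [le_div_iff₀ hlam, zero_mul] at this
    · have := hx'.2; rw [div_le_iff₀ hlam, one_mul] at this; linarith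
  · have hsupp : ∀ x ∉ Icc (0 : ℝ) 1, ψ (x / lam) = 0 := by
      intro x hx
      by_contra h
      have hx' : x / lam ∈ Icc (0 : ℝ) 1 := hψ.2.1 (Function.mem_support.2 h)
      apply hx
      constructor
      · have := hx'.1; rwa [le_div_iff₀ hlam, zero_mul] at this
      · have := hx'.2; rw [div_le_iff₀ hlam, one_mul] at this; linarith
    have hsupp' : ∀ x ∉ Icc (0 : ℝ) 1, ψ x = 0 := by
      intro x hx
      by_contra h
      exact hx (hψ.2.1 (Function.mem_support.2 h))
    rw [setIntegral_eq_integral_of_forall_compl_eq_zero hsupp, Measure.integral_comp_div,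
      ← setIntegral_eq_integral_of_forall_compl_eq_zero hsupp', hψ.2.2, smul_zero]

/-- `T` is additive on `(0,∞)` (locally finite sums). [cite: Burnol2001, §2 (before Thm 2.6)] -/
theorem mapT_add (h₁ : IsTest0 ψ₁) (h₂ : IsTest0 ψ₂) {u : ℝ} (hu : 0 < u) :
    mapT (fun x ↦ ψ₁ x + ψ₂ x) u = mapT ψ₁ u + mapT ψ₂ u := by
  have hM : 1 / u ≤ (⌈1 / u⌉₊ : ℕ) := Nat.le_ceil _
  rw [(h₁.add h₂).mapT_eq_sum_range hu hM, h₁.mapT_eq_sum_range hu hM, h₂.mapT_eq_sum_range hu hM,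
    Finset.sum_add_distrib]

/-- `T(cψ) = cT(ψ)`. [cite: Burnol2001, §2 (before Thm 2.6)] -/
theorem mapT_const_mul (ψ : ℝ → ℂ) (c : ℂ) (u : ℝ) :
    mapT (fun x ↦ c * ψ x) u = c * mapT ψ u := by
  rw [mapT, mapT, tsum_mul_left]

/-- `T(ψ(·/λ))(u) = T(ψ)(u/λ)`. [cite: Burnol2001, §2 (before Thm 2.6)] -/
theorem mapT_comp_div (ψ : ℝ → ℂ) (lam u : ℝ) :
    mapT (fun x ↦ ψ (x / lam)) u = mapT ψ (u / lam) := by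
  simp only [mapT, mul_div_assoc]

/-- `T(ψ)` is a.e.-strongly measurable on `L²(0,1)`'s measure. [cite: Burnol2001, §2 (before Thm 2.6)] -/
theorem aestronglyMeasurable_mapT_Ioo (hψ : IsTest0 ψ) :
    AEStronglyMeasurable (mapT ψ) (volume.restrict (Ioo (0 : ℝ) 1)) :=
  hψ.aestronglyMeasurable_mapT.mono_measure (Measure.restrict_mono_set _ Ioo_subset_Ioi_self)

end IsTest0

/-! ### The approximation property `A(g)`: `g` is an `L²(0,1)`-limit of `T(𝒮⁰_{≤1})`
(spelled out each time: `∀ ε > 0, ∃ ψ ∈ 𝒮⁰_{≤1}, ‖g − T(ψ)‖_{L²(0,1)} < ε`). -/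

/-- `A(0)`. [cite: Burnol2001, §2 (Thm 2.6 ⟹ Thm 2.7)] -/
theorem approxT_zero :
    ∀ ε : ℝ, 0 < ε → ∃ ψ : ℝ → ℂ, IsTest0 ψ ∧
      eLpNorm (fun u : ℝ ↦ (0 : ℂ) - mapT ψ u) 2 (volume.restrict (Ioo (0 : ℝ) 1)) <
        ENNReal.ofReal ε := by
  intro ε hε
  refine ⟨fun _ ↦ 0, IsTest0.zero, ?_⟩
  have : (fun u : ℝ ↦ (0 : ℂ) - mapT (fun _ : ℝ ↦ (0 : ℂ)) u) = fun _ ↦ 0 := by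
    funext u; simp [mapT]
  rw [this, eLpNorm_zero']
  exact ENNReal.ofReal_pos.2 hε

/-- `A` is stable under addition. [cite: Burnol2001, §2 (Thm 2.6 ⟹ Thm 2.7)] -/
theorem approxT_add {g₁ g₂ : ℝ → ℂ}
    (hg₁ : AEStronglyMeasurable g₁ (volume.restrict (Ioo (0 : ℝ) 1)))
    (hg₂ : AEStronglyMeasurable g₂ (volume.restrict (Ioo (0 : ℝ) 1)))
    (h₁ : ∀ ε : ℝ, 0 < ε → ∃ ψ : ℝ → ℂ, IsTest0 ψ ∧
      eLpNorm (fun u : ℝ ↦ g₁ u - mapT ψ u) 2 (volume.restrict (Ioo (0 : ℝ) 1)) < ENNReal.ofReal ε)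
    (h₂ : ∀ ε : ℝ, 0 < ε → ∃ ψ : ℝ → ℂ, IsTest0 ψ ∧
      eLpNorm (fun u : ℝ ↦ g₂ u - mapT ψ u) 2 (volume.restrict (Ioo (0 : ℝ) 1)) < ENNReal.ofReal ε) :
    ∀ ε : ℝ, 0 < ε → ∃ ψ : ℝ → ℂ, IsTest0 ψ ∧
      eLpNorm (fun u : ℝ ↦ (g₁ u + g₂ u) - mapT ψ u) 2 (volume.restrict (Ioo (0 : ℝ) 1)) <
        ENNReal.ofReal ε := by
  intro ε hε
  obtain ⟨ψ₁, hψ₁, e₁⟩ := h₁ (ε / 2) (by positivity)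
  obtain ⟨ψ₂, hψ₂, e₂⟩ := h₂ (ε / 2) (by positivity)
  refine ⟨fun x ↦ ψ₁ x + ψ₂ x, hψ₁.add hψ₂, ?_⟩
  have hae : (fun u : ℝ ↦ (g₁ u + g₂ u) - mapT (fun x ↦ ψ₁ x + ψ₂ x) u) =ᵐ[volume.restrict (Ioo (0 : ℝ) 1)]
      fun u ↦ (g₁ u - mapT ψ₁ u) + (g₂ u - mapT ψ₂ u) := by
    filter_upwards [ae_restrict_mem measurableSet_Ioo] with u hu
    rw [hψ₁.mapT_add hψ₂ hu.1]
    ring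
  rw [eLpNorm_congr_ae hae]
  calc eLpNorm (fun u ↦ (g₁ u - mapT ψ₁ u) + (g₂ u - mapT ψ₂ u)) 2 (volume.restrict (Ioo (0 : ℝ) 1))
      ≤ eLpNorm (fun u ↦ g₁ u - mapT ψ₁ u) 2 (volume.restrict (Ioo (0 : ℝ) 1)) +
          eLpNorm (fun u ↦ g₂ u - mapT ψ₂ u) 2 (volume.restrict (Ioo (0 : ℝ) 1)) :=
        eLpNorm_add_le (hg₁.sub hψ₁.aestronglyMeasurable_mapT_Ioo)
          (hg₂.sub hψ₂.aestronglyMeasurable_mapT_Ioo) (by norm_num)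
    _ < ENNReal.ofReal (ε / 2) + ENNReal.ofReal (ε / 2) := ENNReal.add_lt_add e₁ e₂
    _ = ENNReal.ofReal ε := by rw [← ENNReal.ofReal_add (by positivity) (by positivity)]; ring_nf

/-- `A` is stable under scalars. [cite: Burnol2001, §2 (Thm 2.6 ⟹ Thm 2.7)] -/
theorem approxT_const_mul {g : ℝ → ℂ} (c : ℂ)
    (h : ∀ ε : ℝ, 0 < ε → ∃ ψ : ℝ → ℂ, IsTest0 ψ ∧
      eLpNorm (fun u : ℝ ↦ g u - mapT ψ u) 2 (volume.restrict (Ioo (0 : ℝ) 1)) < ENNReal.ofReal ε) :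
    ∀ ε : ℝ, 0 < ε → ∃ ψ : ℝ → ℂ, IsTest0 ψ ∧
      eLpNorm (fun u : ℝ ↦ c * g u - mapT ψ u) 2 (volume.restrict (Ioo (0 : ℝ) 1)) <
        ENNReal.ofReal ε := by
  intro ε hε
  set ε' : ℝ := ε / (‖c‖ + 1) with hε'
  have hε'0 : 0 < ε' := by positivity
  obtain ⟨ψ, hψ, e⟩ := h ε' hε'0
  refine ⟨fun x ↦ c * ψ x, hψ.const_mul c, ?_⟩
  have hfun : (fun u : ℝ ↦ c * g u - mapT (fun x ↦ c * ψ x) u) = c • fun u ↦ g u - mapT ψ u := by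
    funext u
    simp only [Pi.smul_apply, smul_eq_mul, IsTest0.mapT_const_mul]
    ring
  rw [hfun, eLpNorm_const_smul]
  calc ‖c‖ₑ * eLpNorm (fun u ↦ g u - mapT ψ u) 2 (volume.restrict (Ioo (0 : ℝ) 1))
      ≤ ‖c‖ₑ * ENNReal.ofReal ε' := by gcongr
    _ = ENNReal.ofReal (‖c‖ * ε') := by rw [← ofReal_norm, ENNReal.ofReal_mul (norm_nonneg _)]
    _ < ENNReal.ofReal ε := by
        rw [ENNReal.ofReal_lt_ofReal_iff hε, hε', mul_div_assoc']
        rw [div_lt_iff₀ (by positivity)]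
        nlinarith [norm_nonneg c]

/-- `A` is stable under finite linear combinations. [cite: Burnol2001, §2 (Thm 2.6 ⟹ Thm 2.7)] -/
theorem approxT_sum (g : ℕ → ℝ → ℂ) (c : ℕ → ℂ) (K : ℕ)
    (hgm : ∀ k, k < K → AEStronglyMeasurable (g k) (volume.restrict (Ioo (0 : ℝ) 1)))
    (h : ∀ k, k < K → ∀ ε : ℝ, 0 < ε → ∃ ψ : ℝ → ℂ, IsTest0 ψ ∧
      eLpNorm (fun u : ℝ ↦ g k u - mapT ψ u) 2 (volume.restrict (Ioo (0 : ℝ) 1)) <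
        ENNReal.ofReal ε) :
    ∀ ε : ℝ, 0 < ε → ∃ ψ : ℝ → ℂ, IsTest0 ψ ∧
      eLpNorm (fun u : ℝ ↦ (∑ k ∈ Finset.range K, c k * g k u) - mapT ψ u) 2
        (volume.restrict (Ioo (0 : ℝ) 1)) < ENNReal.ofReal ε := by
  induction K with
  | zero => simpa using approxT_zero
  | succ K ih =>
    have hK : ∀ ε : ℝ, 0 < ε → ∃ ψ : ℝ → ℂ, IsTest0 ψ ∧
        eLpNorm (fun u : ℝ ↦ (∑ k ∈ Finset.range K, c k * g k u) - mapT ψ u) 2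
          (volume.restrict (Ioo (0 : ℝ) 1)) < ENNReal.ofReal ε :=
      ih (fun k hk ↦ hgm k (Nat.lt_succ_of_lt hk)) (fun k hk ↦ h k (Nat.lt_succ_of_lt hk))
    have hlast := approxT_const_mul (c K) (h K (Nat.lt_succ_self K))
    have hm1 : AEStronglyMeasurable (fun u : ℝ ↦ ∑ k ∈ Finset.range K, c k * g k u)
        (volume.restrict (Ioo (0 : ℝ) 1)) :=
      Finset.aestronglyMeasurable_fun_sum _ fun k hk ↦
        (hgm k (Nat.lt_succ_of_lt (Finset.mem_range.1 hk))).const_mul _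
    have hm2 : AEStronglyMeasurable (fun u : ℝ ↦ c K * g K u) (volume.restrict (Ioo (0 : ℝ) 1)) :=
      (hgm K (Nat.lt_succ_self K)).const_mul _
    have := approxT_add hm1 hm2 hK hlast
    simpa only [Finset.sum_range_succ] using this

/-- **Dilation step.** If `1` is an `L²(0,1)`-limit of `T(𝒮⁰_{≤1})`, so is `𝟙_{(0,b]}` for every
`0 ≤ b ≤ 1`: `‖𝟙_{(0,b]} − T(ψ(·/b))‖²_{L²(0,1)} = b‖1 − T(ψ)‖²_{L²(0,1)}` (`T(ψ) = 0` on `(1,∞)`).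
[cite: Burnol2001, §2 (Thm 2.6 ⟹ Thm 2.7)] -/
theorem approxT_indicator
    (h1 : ∀ ε : ℝ, 0 < ε → ∃ ψ : ℝ → ℂ, IsTest0 ψ ∧
      eLpNorm (fun u : ℝ ↦ (1 : ℂ) - mapT ψ u) 2 (volume.restrict (Ioo (0 : ℝ) 1)) < ENNReal.ofReal ε)
    {b : ℝ} (hb0 : 0 ≤ b) (hb1 : b ≤ 1) :
    ∀ ε : ℝ, 0 < ε → ∃ ψ : ℝ → ℂ, IsTest0 ψ ∧
      eLpNorm (fun u : ℝ ↦ (Ioc (0 : ℝ) b).indicator (fun _ ↦ (1 : ℂ)) u - mapT ψ u) 2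
        (volume.restrict (Ioo (0 : ℝ) 1)) < ENNReal.ofReal ε := by
  rcases hb0.eq_or_lt with hb | hb
  · subst hb
    simpa only [Ioc_self, indicator_empty] using approxT_zero
  intro ε hε
  obtain ⟨ψ, hψ, e⟩ := h1 ε hε
  refine ⟨fun x ↦ ψ (x / b), hψ.comp_div hb hb1, lt_of_le_of_lt ?_ e⟩
  -- the difference is the dilate of `D = 𝟙_{(0,1]}(1 − Tψ)`
  set D : ℝ → ℂ := (Ioc (0 : ℝ) 1).indicator (fun v ↦ (1 : ℂ) - mapT ψ v) with hD
  have hDm : AEStronglyMeasurable D volume := by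
    rw [hD, aestronglyMeasurable_indicator_iff measurableSet_Ioc]
    exact aestronglyMeasurable_const.sub
      ((hψ.continuousOn_mapT.mono Ioc_subset_Ioi_self).aestronglyMeasurable measurableSet_Ioc)
  have hpt : ∀ u ∈ Ioo (0 : ℝ) 1,
      (Ioc (0 : ℝ) b).indicator (fun _ ↦ (1 : ℂ)) u - mapT (fun x ↦ ψ (x / b)) u = D (b⁻¹ * u) := by
    intro u hu
    rw [IsTest0.mapT_comp_div, inv_mul_eq_div, hD]
    by_cases hub : u ≤ b
    · have hm : u / b ∈ Ioc (0 : ℝ) 1 := ⟨div_pos hu.1 hb, by rw [div_le_one hb]; exact hub⟩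
      rw [indicator_of_mem (show u ∈ Ioc (0 : ℝ) b from ⟨hu.1, hub⟩), indicator_of_mem hm]
    · have hub' : 1 < u / b := by rw [lt_div_iff₀ hb, one_mul]; exact not_le.1 hub
      rw [indicator_of_notMem (fun h : u ∈ Ioc (0 : ℝ) b ↦ hub h.2),
        indicator_of_notMem (fun h : u / b ∈ Ioc (0 : ℝ) 1 ↦ not_le.2 hub' h.2),
        hψ.mapT_eq_zero_of_one_lt hub', sub_zero]
  have hae : (fun u : ℝ ↦ (Ioc (0 : ℝ) b).indicator (fun _ ↦ (1 : ℂ)) u - mapT (fun x ↦ ψ (x / b)) u)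
      =ᵐ[volume.restrict (Ioo (0 : ℝ) 1)] fun u ↦ D (b⁻¹ * u) := by
    filter_upwards [ae_restrict_mem measurableSet_Ioo] with u hu using hpt u hu
  rw [eLpNorm_congr_ae hae]
  have hb' : b⁻¹ ≠ 0 := inv_ne_zero hb.ne'
  calc eLpNorm (fun u ↦ D (b⁻¹ * u)) 2 (volume.restrict (Ioo (0 : ℝ) 1))
      ≤ eLpNorm (fun u ↦ D (b⁻¹ * u)) 2 volume := eLpNorm_mono_measure _ Measure.restrict_le_self
    _ = eLpNorm D 2 (Measure.map (fun u : ℝ ↦ b⁻¹ * u) volume) := by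
        rw [eLpNorm_map_measure _ (measurable_const_mul _).aemeasurable]
        · rfl
        · rw [Real.map_volume_mul_left hb']
          exact hDm.smul_measure _
    _ = ENNReal.ofReal |b⁻¹⁻¹| ^ (1 / (2 : ENNReal)).toReal * eLpNorm D 2 volume := by
        rw [Real.map_volume_mul_left hb', eLpNorm_smul_measure_of_ne_top (by norm_num), smul_eq_mul]
    _ ≤ 1 * eLpNorm D 2 volume := by
        gcongr
        refine ENNReal.rpow_le_one (ENNReal.ofReal_le_one.2 ?_) (by simp)
        rw [inv_inv, abs_of_pos hb]; exact hb1
    _ = eLpNorm (fun u : ℝ ↦ (1 : ℂ) - mapT ψ u) 2 (volume.restrict (Ioo (0 : ℝ) 1)) := by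
        rw [one_mul, hD, eLpNorm_indicator_eq_eLpNorm_restrict measurableSet_Ioc,
          Measure.restrict_congr_set Ioo_ae_eq_Ioc]

/-- Evaluation of the uniform-grid step function at `u ∈ (0,1)`: it picks the value at the right
end point `⌈Ku⌉/K` of the cell containing `u`, which is within `1/K` of `u`. [folklore] -/
private theorem step_apply (h : ℝ → ℂ) {K : ℕ} (hK : 0 < K) {u : ℝ} (hu : u ∈ Ioo (0 : ℝ) 1) :
    (∑ k ∈ Finset.range K, h ((k + 1 : ℕ) / K) *
      ((Ioc (0 : ℝ) ((k + 1 : ℕ) / K)).indicator (fun _ ↦ (1 : ℂ)) u -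
        (Ioc (0 : ℝ) (k / K)).indicator (fun _ ↦ (1 : ℂ)) u) = h (⌈(K : ℝ) * u⌉₊ / K)) ∧
    |u - ⌈(K : ℝ) * u⌉₊ / K| < 1 / K := by
  have hK0 : (0 : ℝ) < K := Nat.cast_pos.2 hK
  have hKu0 : 0 < (K : ℝ) * u := mul_pos hK0 hu.1
  have hKu1 : (K : ℝ) * u < K := by nlinarith [hu.2]
  have hc1 : 1 ≤ ⌈(K : ℝ) * u⌉₊ := Nat.succ_le_of_lt (Nat.ceil_pos.2 hKu0)
  have hcK : ⌈(K : ℝ) * u⌉₊ ≤ K := Nat.ceil_le.2 hKu1.le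
  have hcu : (K : ℝ) * u ≤ ⌈(K : ℝ) * u⌉₊ := Nat.le_ceil _
  have hcu' : (⌈(K : ℝ) * u⌉₊ : ℝ) < K * u + 1 := Nat.ceil_lt_add_one hKu0.le
  have hind : ∀ x : ℝ, (Ioc (0 : ℝ) x).indicator (fun _ ↦ (1 : ℂ)) u = if u ≤ x then 1 else 0 := by
    intro x
    by_cases hx : u ≤ x
    · rw [indicator_of_mem (show u ∈ Ioc (0 : ℝ) x from ⟨hu.1, hx⟩), if_pos hx]
    · rw [indicator_of_notMem (fun h' : u ∈ Ioc (0 : ℝ) x ↦ hx h'.2), if_neg hx]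
  have hle : ∀ k : ℕ, (u ≤ (k : ℝ) / K ↔ ⌈(K : ℝ) * u⌉₊ ≤ k) := by
    intro k
    rw [le_div_iff₀ hK0, mul_comm, Nat.ceil_le]
  have hterm : ∀ k ∈ Finset.range K, h ((k + 1 : ℕ) / K) *
      ((Ioc (0 : ℝ) ((k + 1 : ℕ) / K)).indicator (fun _ ↦ (1 : ℂ)) u -
        (Ioc (0 : ℝ) (k / K)).indicator (fun _ ↦ (1 : ℂ)) u) =
      if k = ⌈(K : ℝ) * u⌉₊ - 1 then h ((k + 1 : ℕ) / K) else 0 := by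
    intro k _
    rw [hind, hind]
    by_cases h1 : ⌈(K : ℝ) * u⌉₊ ≤ k
    · have h2 : ⌈(K : ℝ) * u⌉₊ ≤ k + 1 := Nat.le_succ_of_le h1
      rw [if_pos ((hle (k + 1)).2 h2), if_pos ((hle k).2 h1), sub_self, mul_zero, if_neg (by omega)]
    · by_cases h2 : ⌈(K : ℝ) * u⌉₊ ≤ k + 1
      · have : k = ⌈(K : ℝ) * u⌉₊ - 1 := by omega
        rw [if_pos ((hle (k + 1)).2 h2), if_neg (fun h' ↦ h1 ((hle k).1 h')), sub_zero, mul_one,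
          if_pos this]
      · rw [if_neg (fun h' ↦ h2 ((hle (k + 1)).1 h')), if_neg (fun h' ↦ h1 ((hle k).1 h')),
          sub_self, mul_zero, if_neg (by omega)]
  rw [Finset.sum_congr rfl hterm, Finset.sum_ite_eq' (Finset.range K) (⌈(K : ℝ) * u⌉₊ - 1)
    (fun k ↦ h ((k + 1 : ℕ) / K)), if_pos (Finset.mem_range.2 (by omega))]
  constructor
  · simp only [Nat.sub_add_cancel hc1]
  · have e : u - (⌈(K : ℝ) * u⌉₊ : ℝ) / K = -(((⌈(K : ℝ) * u⌉₊ : ℝ) - K * u) / K) := by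
      field_simp
      ring
    rw [e, abs_neg, abs_of_nonneg (div_nonneg (by linarith) hK0.le),
      div_lt_div_iff_of_pos_right hK0]
    linarith

/-- **Step-function step.** If `1` is an `L²(0,1)`-limit of `T(𝒮⁰_{≤1})`, so is every continuous
compactly supported `h` (uniform continuity: `h` is within `ε/2` of its uniform-grid step
function on `(0,1)`, and `Ioc`-steps are differences of the `𝟙_{(0,b]}`).
[cite: Burnol2001, §2 (Thm 2.6 ⟹ Thm 2.7)] -/
theorem approxT_continuous
    (h1 : ∀ ε : ℝ, 0 < ε → ∃ ψ : ℝ → ℂ, IsTest0 ψ ∧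
      eLpNorm (fun u : ℝ ↦ (1 : ℂ) - mapT ψ u) 2 (volume.restrict (Ioo (0 : ℝ) 1)) < ENNReal.ofReal ε)
    {h : ℝ → ℂ} (hc : Continuous h) (hcs : HasCompactSupport h) :
    ∀ ε : ℝ, 0 < ε → ∃ ψ : ℝ → ℂ, IsTest0 ψ ∧
      eLpNorm (fun u : ℝ ↦ h u - mapT ψ u) 2 (volume.restrict (Ioo (0 : ℝ) 1)) <
        ENNReal.ofReal ε := by
  intro ε hε
  have huc : UniformContinuous h := hcs.uniformContinuous_of_continuous hc
  obtain ⟨δ, hδ, hδε⟩ := Metric.uniformContinuous_iff.1 huc (ε / 2) (by positivity)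
  obtain ⟨K, hK⟩ : ∃ K : ℕ, 1 / δ < K := exists_nat_gt _
  have hK0 : 0 < (K : ℝ) := lt_trans (by positivity) hK
  have hKnat : 0 < K := Nat.cast_pos.1 hK0
  have hKδ : 1 / (K : ℝ) < δ := by rw [div_lt_comm₀ hK0 hδ]; exact hK
  -- the step function and its approximability
  set σ : ℝ → ℂ := fun u ↦ ∑ k ∈ Finset.range K, h ((k + 1 : ℕ) / K) *
      ((Ioc (0 : ℝ) ((k + 1 : ℕ) / K)).indicator (fun _ ↦ (1 : ℂ)) u -
        (Ioc (0 : ℝ) (k / K)).indicator (fun _ ↦ (1 : ℂ)) u) with hσ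
  have hind_meas : ∀ x : ℝ, AEStronglyMeasurable ((Ioc (0 : ℝ) x).indicator (fun _ ↦ (1 : ℂ)))
      (volume.restrict (Ioo (0 : ℝ) 1)) :=
    fun x ↦ aestronglyMeasurable_const.indicator measurableSet_Ioc
  have hgm : ∀ k : ℕ, k < K → AEStronglyMeasurable (fun u : ℝ ↦
      (Ioc (0 : ℝ) ((k + 1 : ℕ) / K)).indicator (fun _ ↦ (1 : ℂ)) u -
        (Ioc (0 : ℝ) (k / K)).indicator (fun _ ↦ (1 : ℂ)) u) (volume.restrict (Ioo (0 : ℝ) 1)) :=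
    fun k _ ↦ (hind_meas _).sub (hind_meas _)
  have hA : ∀ ε : ℝ, 0 < ε → ∃ ψ : ℝ → ℂ, IsTest0 ψ ∧
      eLpNorm (fun u : ℝ ↦ σ u - mapT ψ u) 2 (volume.restrict (Ioo (0 : ℝ) 1)) <
        ENNReal.ofReal ε := by
    refine approxT_sum (fun k u ↦ (Ioc (0 : ℝ) ((k + 1 : ℕ) / K)).indicator (fun _ ↦ (1 : ℂ)) u -
        (Ioc (0 : ℝ) (k / K)).indicator (fun _ ↦ (1 : ℂ)) u) (fun k ↦ h ((k + 1 : ℕ) / K)) K hgm ?_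
    intro k hk
    have hb1 : ((k + 1 : ℕ) : ℝ) / K ≤ 1 := by
      rw [div_le_one hK0]; exact_mod_cast hk
    have hb1' : (k : ℝ) / K ≤ 1 := by
      rw [div_le_one hK0]; exact_mod_cast hk.le
    have := approxT_add (hind_meas _) ((hind_meas ((k : ℝ) / K)).const_mul (-1))
      (approxT_indicator h1 (b := ((k + 1 : ℕ) : ℝ) / K) (by positivity) hb1)
      (approxT_const_mul (-1) (approxT_indicator h1 (b := (k : ℝ) / K) (by positivity) hb1'))
    simpa only [neg_one_mul, ← sub_eq_add_neg] using this
  obtain ⟨ψ, hψ, e⟩ := hA (ε / 2) (by positivity)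
  refine ⟨ψ, hψ, ?_⟩
  -- `h` is uniformly within `ε/2` of `σ` on `(0,1)`
  have hpt : ∀ u ∈ Ioo (0 : ℝ) 1, ‖h u - σ u‖ ≤ ε / 2 := by
    intro u hu
    obtain ⟨hval, hdist⟩ := step_apply h hKnat hu
    have hσu : σ u = h (⌈(K : ℝ) * u⌉₊ / K) := by rw [hσ]; exact hval
    rw [hσu, ← dist_eq_norm]
    refine (hδε ?_).le
    rw [Real.dist_eq]
    exact hdist.trans hKδ
  have hσm : AEStronglyMeasurable σ (volume.restrict (Ioo (0 : ℝ) 1)) := by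
    rw [hσ]
    exact Finset.aestronglyMeasurable_fun_sum _ fun k hk ↦
      (hgm k (Finset.mem_range.1 hk)).const_mul _
  have hbd : eLpNorm (fun u ↦ h u - σ u) 2 (volume.restrict (Ioo (0 : ℝ) 1)) ≤
      ENNReal.ofReal (ε / 2) := by
    have := eLpNorm_le_of_ae_bound (p := 2) (μ := volume.restrict (Ioo (0 : ℝ) 1))
      (f := fun u ↦ h u - σ u) (C := ε / 2)
      (by filter_upwards [ae_restrict_mem measurableSet_Ioo] with u hu using hpt u hu)
    simpa [Measure.restrict_apply_univ, Real.volume_Ioo] using this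
  have hsplit : (fun u ↦ h u - mapT ψ u) = fun u ↦ (h u - σ u) + (σ u - mapT ψ u) := by
    funext u; ring
  rw [hsplit]
  calc eLpNorm (fun u ↦ (h u - σ u) + (σ u - mapT ψ u)) 2 (volume.restrict (Ioo (0 : ℝ) 1))
      ≤ eLpNorm (fun u ↦ h u - σ u) 2 (volume.restrict (Ioo (0 : ℝ) 1)) +
          eLpNorm (fun u ↦ σ u - mapT ψ u) 2 (volume.restrict (Ioo (0 : ℝ) 1)) :=
        eLpNorm_add_le (hc.aestronglyMeasurable.sub hσm) (hσm.sub hψ.aestronglyMeasurable_mapT_Ioo)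
          (by norm_num)
    _ < ENNReal.ofReal (ε / 2) + ENNReal.ofReal (ε / 2) :=
        ENNReal.add_lt_add_of_le_of_lt (ne_top_of_le_ne_top ENNReal.ofReal_ne_top hbd) hbd e
    _ = ENNReal.ofReal ε := by rw [← ENNReal.ofReal_add (by positivity) (by positivity)]; ring_nf

/-- **Density.** If `1` is an `L²(0,1)`-limit of `T(𝒮⁰_{≤1})`, then so is every
`g ∈ L²((0,1))` (continuous compactly supported functions are dense in `L²`).
[cite: Burnol2001, §2 (Thm 2.6 ⟹ Thm 2.7)] -/
theorem approxT_memLp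
    (h1 : ∀ ε : ℝ, 0 < ε → ∃ ψ : ℝ → ℂ, IsTest0 ψ ∧
      eLpNorm (fun u : ℝ ↦ (1 : ℂ) - mapT ψ u) 2 (volume.restrict (Ioo (0 : ℝ) 1)) < ENNReal.ofReal ε)
    {g : ℝ → ℂ} (hg : MemLp g 2 (volume.restrict (Ioo (0 : ℝ) 1))) :
    ∀ ε : ℝ, 0 < ε → ∃ ψ : ℝ → ℂ, IsTest0 ψ ∧
      eLpNorm (fun u : ℝ ↦ g u - mapT ψ u) 2 (volume.restrict (Ioo (0 : ℝ) 1)) <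
        ENNReal.ofReal ε := by
  intro ε hε
  haveI : (volume.restrict (Ioo (0 : ℝ) 1)).Regular :=
    Measure.Regular.restrict_of_measure_ne_top (by simp)
  obtain ⟨h, hcs, hle, hcont, -⟩ := hg.exists_hasCompactSupport_eLpNorm_sub_le (by norm_num)
    (ε := ENNReal.ofReal (ε / 2)) (by simpa using hε)
  obtain ⟨ψ, hψ, e⟩ := approxT_continuous h1 hcont hcs (ε / 2) (by positivity)
  refine ⟨ψ, hψ, ?_⟩
  have hsplit : (fun u ↦ g u - mapT ψ u) = fun u ↦ (g - h) u + (h u - mapT ψ u) := by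
    funext u; simp only [Pi.sub_apply]; ring
  rw [hsplit]
  calc eLpNorm (fun u ↦ (g - h) u + (h u - mapT ψ u)) 2 (volume.restrict (Ioo (0 : ℝ) 1))
      ≤ eLpNorm (g - h) 2 (volume.restrict (Ioo (0 : ℝ) 1)) +
          eLpNorm (fun u ↦ h u - mapT ψ u) 2 (volume.restrict (Ioo (0 : ℝ) 1)) :=
        eLpNorm_add_le (hg.1.sub hcont.aestronglyMeasurable)
          (hcont.aestronglyMeasurable.sub hψ.aestronglyMeasurable_mapT_Ioo) (by norm_num)
    _ < ENNReal.ofReal (ε / 2) + ENNReal.ofReal (ε / 2) :=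
        ENNReal.add_lt_add_of_le_of_lt (ne_top_of_le_ne_top ENNReal.ofReal_ne_top hle) hle e
    _ = ENNReal.ofReal ε := by rw [← ENNReal.ofReal_add (by positivity) (by positivity)]; ring_nf

end Burnol2001

open Burnol2001 in
/-- **Burnol 2001, Thm 2.7 (equality clause), the half `RH ⟹ cl V E(𝒮_{≤1}) = ℍ²`.**
Under RH, Thm 2.6 (`periodization_closure_of_riemannHypothesis`) and the density lemma
`approxT_memLp` make every `g ∈ L²(0,1)` an `L²(0,1)`-limit of `T(ψ)`, `ψ ∈ 𝒮⁰_{≤1}`; each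
`T(ψ)` is a `V E(φ̃)`, `φ̃ ∈ 𝒮_{≤1}`, on `(0,∞)` (`IsTest0.exists_isTest_opV_mapE_eq`), and for
`g ∈ ℍ²` (a.e. zero on `(1,∞)`, where `T(ψ)` vanishes too) the `L²((0,∞))`-distance to `V E(φ̃)`
is the `L²((0,1))`-distance to `T(ψ)`. (Elementary replacement of Burnol's Beurling–Lax road,
see the section docstring.) [cite: Burnol2001, Thm 2.7 (arXiv v3 l.497–499)] -/
theorem opV_mapE_closure_of_riemannHypothesis (hRH : RiemannHypothesis) :
    ∀ g : ℝ → ℂ, InH2 g →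
      ∀ ε : ℝ, 0 < ε → ∃ φ : ℝ → ℂ, IsTest φ ∧
        eLpNorm (fun u : ℝ ↦ g u - opV (mapE φ) u) 2 (volume.restrict (Ioi (0 : ℝ))) <
          ENNReal.ofReal ε := by
  intro g hg ε hε
  have h26 := periodization_closure_of_riemannHypothesis hRH
  have hg01 : MemLp g 2 (volume.restrict (Ioo (0 : ℝ) 1)) :=
    hg.1.mono_measure (Measure.restrict_mono_set _ Ioo_subset_Ioi_self)
  obtain ⟨ψ, hψ, e⟩ := approxT_memLp h26 hg01 ε hε
  obtain ⟨φ, hφ, hVE⟩ := hψ.exists_isTest_opV_mapE_eq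
  refine ⟨φ, hφ, ?_⟩
  -- on `(0,∞)` the difference `g − V E(φ) = g − T(ψ)` lives on `(0,1]`
  have hg2 : ∀ᵐ u ∂(volume.restrict (Ioi (0 : ℝ))), u ∈ Ioi (1 : ℝ) → g u = 0 :=
    ae_restrict_of_ae ((ae_restrict_iff' measurableSet_Ioi).1 hg.2)
  have hae : (fun u : ℝ ↦ g u - opV (mapE φ) u) =ᵐ[volume.restrict (Ioi (0 : ℝ))]
      (Ioc (0 : ℝ) 1).indicator (fun u ↦ g u - mapT ψ u) := by
    filter_upwards [ae_restrict_mem measurableSet_Ioi, hg2] with u hu hgu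
    rw [hVE u hu]
    by_cases hu1 : u ≤ 1
    · rw [indicator_of_mem (show u ∈ Ioc (0 : ℝ) 1 from ⟨hu, hu1⟩)]
    · have hu1' : 1 < u := not_le.1 hu1
      rw [indicator_of_notMem (fun h : u ∈ Ioc (0 : ℝ) 1 ↦ hu1 h.2), hgu hu1',
        hψ.mapT_eq_zero_of_one_lt hu1', sub_zero]
  rw [eLpNorm_congr_ae hae, eLpNorm_indicator_eq_eLpNorm_restrict measurableSet_Ioc,
    Measure.restrict_restrict measurableSet_Ioc, inter_eq_left.2 Ioc_subset_Ioi_self,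
    ← Measure.restrict_congr_set Ioo_ae_eq_Ioc]
  exact e

/-- DISCHARGE of the named fact **Burnol 2001, Thm 2.7 (equality clause)**:
`cl(V E(𝒮_{≤1})) = ℍ² ⟺ RH`, proved AS AN EQUIVALENCE (neither side asserted):
`⟹` is `riemannHypothesis_of_opV_mapE_closure` (Burnol's printed Mellin computation),
`⟸` is `opV_mapE_closure_of_riemannHypothesis` (Thm 2.6 + dilations + `V E(φ̃) = T(ψ)`).
[cite: Burnol2001, Thm 2.7 (arXiv v3 l.497–499)] -/
theorem Burnol2001_thm_2_7_iff_holds : Burnol2001_thm_2_7_iff :=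
  ⟨riemannHypothesis_of_opV_mapE_closure, opV_mapE_closure_of_riemannHypothesis⟩

end Literature.NumberTheory.LFunctions

end
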